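import Literature.Analysis.ValidatedNumerics.TaylorModelZeroCert
import HarnessLib

/-!
# Kernel-checked variation tables and global extrema of straight-line programs on an interval:
# monotonicity leaves, critical-point leaves, exact critical-point counts, local extrema, and the global
# minimum / maximum with their unique extremisers

Trunk T-ANA (Analysis/ValidatedNumerics); namespace `Literature.Analysis.ValidatedNumerics.PolyMP`.
Sequel of `TaylorModelZeroCert.lean` (exclusion and interval-Newton LEAVES for the zeros of `P(ps; ·) = F.toFunP p ps`
of a program `p : GProg M` of a statement family `M : OpModel`, `F : OpSem M`, `T : OpTangent M F`; the exact
zero-structure predicate `ZClaim` with `ZClaim.append` / `ZClaim.ncard_eq`; the `#eval` generators) and of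
`TaylorModelTangentProgram.lean` (the tangent program `T.deriv p` with the kernel-checked guard `T.guardCheckP`
under which `∀ t ∈ [c − h, c + h], HasDerivAt (P(ps; ·)) (Ṗ(ps; t)) t`, `hasDerivAt_of_guardCheckP`).  This module
COMPOSES the two, one differentiation order up: the interval Newton leaf applied to the TANGENT program `T.deriv p`
(it models the second tangent program `T.deriv (T.deriv p)`) certifies EXACTLY ONE CRITICAL POINT of `P(ps; ·)` in
a leaf, a Taylor model of `T.deriv p` of one sign certifies a row of STRICT MONOTONICITY (the monotonicity test of
interval global optimisation), and a nonempty, consistent list of such leaves tiling `[a, b]`, with point models of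
`p` at the endpoints and models of `p` on the critical boxes, certifies the complete VARIATION TABLE of `P(ps; ·)`
on `[a, b]` — hence its local extrema, the global minimum and maximum values, and (by the midpoint test on the
finitely many candidates: the endpoints and the critical points) the global minimisers and maximisers — decided
by `decide +kernel`, uniformly over a parameter box `B` (`BoxMem ps B`), for ANY family of the lane (`SOp`,
`TOp`, `AOp`):

* Part A — VARIATION TABLES OVER `ℝ` for an arbitrary `f` (no models): rows `MonoDir f d u v` (strictly
  increasing / decreasing on `[u, v]`), tables `VarRows f u R` from `u` with breakpoints `bps u R` and last point
  `rowsEnd u R`, the glue `VarRows.glue` (tables of `[u, m]` and `[m, v]` whose directions agree at `m` merge, by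
  `StrictMonoOn.union`), rows from a signed derivative (`strictMonoOn_of_hasDerivAt_pos` /
  `strictAntiOn_of_hasDerivAt_neg`, Mathlib's `strictMonoOn_of_deriv_pos`), every value dominates [is dominated
  by] a breakpoint value (`VarRows.exists_bp_le` / `exists_bp_ge`), extremisers are breakpoints
  (`mem_bps_of_isMinOn` / `mem_bps_of_isMaxOn`), local extrema at direction flips (`isLocalExtr_of_flip`); and the
  GLOBAL-EXTREMA PACKAGE from scaled-integer value enclosures of the breakpoints (`BVal`: a box and
  `f(w)·S ∈ [vlo, vhi]`, `BVal.ok`; `minLo` / `minHi` / `maxLo` / `maxHi`; the SURVIVORS `minSurv` / `maxSurv` of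
  the midpoint test — the boxes whose lower value bound does not exceed the least upper bound): the lower bound
  `VarRows.minLo_le`, attainment below `minHi` (`exists_le_minHi`), every global minimiser lies in a surviving box
  (`minSurv_of_isMinOn`), a single survivor ⇒ `∃!` global minimiser, inside it (`existsUnique_isMinOn`); duals
  `le_maxHi`, `exists_maxLo_le`, `maxSurv_of_isMaxOn`, `existsUnique_isMaxOn`.
* Part B — the two LEAF certificates on `X = [c − h, c + h]` and their soundness: the MONOTONICITY leaf
  `T.monoLeafCheck` (guard certificate of `p` on `X`, so that `Ṗ` is the derivative; model of `T.deriv p` on `X`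
  with `0 < Ṗ̲` (`up`) / `Ṗ̄ < 0`) ⇒ the derivative on `X` and a one-row table (`sound_of_monoLeafCheck`); the
  CRITICAL-POINT leaf `T.critLeafCheck` (guard of `p` on `X`; the interval Newton leaf `T.newtonLeafCheck` of
  `TaylorModelZeroCert` for the PROGRAM `T.deriv p` on `X` with claimed enclosure `[zlo, zhi]`; the KIND read off
  the point model of `T.deriv p` at the left end `c − h` — `Ṗ(c − h) < 0` ⇒ local minimum, `> 0` ⇒ local maximum,
  sound because `Ṗ` has exactly one zero in `X` and is strictly monotone there; and the VALUE model of `p` on the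
  box `[zlo, zhi]`) ⇒ exactly one critical point `z ∈ [zlo, zhi] ⊂ (c − h, c + h)`, `P(ps; ·)` strictly anti/mono
  on `[c − h, z]` and mono/anti on `[z, c + h]`, `P(ps; z)·S ∈ [vlo, vhi]` (`sound_of_critLeafCheck`,
  `eTable_of_critLeafCheck`, `isLocalExtr_of_eLeafCheck`, `zclaim_of_eLeafCheck`).  The TABLE CLAIM
  `ETable S f f' x y K e` (rows matching the specification `K` — directions, boxes and value enclosures of the
  interior breakpoints —, last direction `e`, and: the zeros of `f'` in `[x, y]` ARE the interior breakpoints),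
  `ETable.append` (segment certificates `[x, m]`, `[m, y]` glue when the directions agree at `m`) and
  `ETable.rows` (attach the endpoint values and hand over to Part A).
* Part C — the EXTREMA CERTIFICATE `T.extremaCheck prm S p B a b C` for `C : ECert` (leaves `L : List ELeaf`
  tiling `[a, b]` in order (`tiles`) and `consistent` — exit direction of each leaf = entry direction of the
  next —, the endpoint point-model candidates, the CLAIMED value bounds `mlo ≤ min ≤ mhi`, `xlo ≤ max ≤ xhi`, and
  optionally the claimed unique minimiser / maximiser box) = the header `M.extremaHdrCheck` `&&` the leaves
  `T.eLeavesCheck`; for a certificate too big for one kernel call the header and chunks of leaves are decided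
  separately (`extremaCheck_of_parts`, `eLeavesCheck_of_take_drop`, `eLeavesCheck_append`).  SOUNDNESS, for every
  `ps ∈ B` (`sound_of_eLeavesCheck` along the chain, then): (1) `hasDerivAt_of_extremaCheck` — `Ṗ(ps; ·)` is the
  derivative on `[a, b]`; (2) `critical_of_extremaCheck` — the critical points of `P(ps; ·)` on `[a, b]` ARE a
  strictly increasing list, one per critical-point leaf and inside its box (`ZClaim`), `ncard_critical_of_extremaCheck`
  (exactly `|eEncls C.L|` critical points); (3) `varTable_of_extremaCheck` — the complete variation table (rows as
  specified by `M.eSpec`, the zeros of `Ṗ` = the interior breakpoints, a local minimum at every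
  decreasing→increasing breakpoint and a local maximum at every increasing→decreasing one);
  (4) `isLocalExtr_of_extremaCheck` per critical-point leaf; (5) `min_of_extremaCheck` / `max_of_extremaCheck` —
  `mlo ≤ P(ps; t) ≤ xhi` on `[a, b]`, `∃ t, P(ps; t) ≤ mhi`, `∃ t, xlo ≤ P(ps; t)` (so `min ∈ [mlo, mhi]`,
  `max ∈ [xlo, xhi]`); (6) `isMinOn_mem_of_extremaCheck` / `isMaxOn_mem_of_extremaCheck` — every global minimiser
  [maximiser] on `[a, b]` lies in a surviving candidate box of `minSurv (M.eVals …)` [`maxSurv`];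
  (7) `existsUnique_isMinOn_of_extremaCheck` / `existsUnique_isMaxOn_of_extremaCheck` — a claimed unique box ⇒
  `∃!` global minimiser [maximiser] on `[a, b]`, and it lies in the box.
* Part D — certificate generation by `#eval` (untrusted, PROPOSAL only; every leaf and every claim is re-checked
  by the kernel): the critical points are located by the sign-change scan and bisection of `TaylorModelZeroCert`
  on the point values of `T.deriv p` (`M.scanCells`, `M.bisectRoot`); `T.critLeafOf` (the Newton proposal
  `T.newtonLeafOf` for `T.deriv p`, the kind from the point value at `c − h`); adaptive monotonicity tilings
  `T.monoAdapt` / `T.monoGap` (direction from the point value of `T.deriv p` at the centre, dyadic bisection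
  until `monoLeafCheck` accepts); the assembly `T.extremaGenFrom` / `T.extremaGen : … → ECert × Bool` (claimed
  bounds = the computed ones, a unique box claimed exactly when one candidate survives).

Worked end to end (scratch kept OUT of the tree, `Certquad.ScratchExtrema`; `S = 2⁶⁰`, truncation degree `12`,
critical-point leaves of half-width `1/64`; the whole scratch — three certificates, the identification lemmas and
the corollaries below as hypothesis-free theorems about the named real functions, two refusals — checks in `92 s`
on the farm with the standard axioms): `t⁵ − 3t + 1` on `[−2, 2]` (`SOp`; 13 leaves, ONE `decide +kernel`, under
`2 s`): the range is `[−25, 27]` (exact: endpoint candidates have point boxes), the unique global minimiser is `−2`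
and the unique global maximiser is `2`, there are exactly two critical points (`Set.ncard` of the zeros of `deriv`
on `[−2, 2]` is `2`) — a local maximum at `−(3/5)^{1/4} = −0.880111736793393…` and a local minimum at `(3/5)^{1/4}`,
each enclosed to width `3.2·10⁻¹⁷`; `t e^{−t}` on `[0, 4]` (`SOp`; 21 leaves, one kernel call): the maximum value is
enclosed to width `1.7·10⁻¹⁶` around `1/e`, there is exactly one global maximiser, enclosed to width `9.4·10⁻¹⁶`
around `1`, and the minimum `0` is attained only at `t = 0`; `sin t + sin(10t/3)` on `[2.7, 7.5]` (`TOp`; a standard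
univariate test problem of global optimisation; 26 leaves — 5 critical-point leaves, on which the Newton step for
the 31-statement tangent program models the 187-statement second tangent program, and 21 monotonicity leaves;
decided as header + two chunks of 13 leaves, `≈ 40 s` each, since one kernel call on all 26 leaves exceeds the
farm's per-process memory): exactly five critical points in `[2.7, 7.5]`; the global minimum value is enclosed to
width `6.1·10⁻¹⁵` around `−1.8995993491521…` and the global maximum value to width `5·10⁻¹⁵` around
`0.8883147801206…`; there is exactly one global minimiser, enclosed to width `1.3·10⁻¹⁵` around `5.145735290256…`,
and exactly one global maximiser, enclosed likewise around `6.217308850424…`; and two refusals (`= false` by the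
kernel): the quintic's local-maximum leaf claimed as a local minimum, and a critical-point leaf around the
degenerate critical point `0` of `t³`.

Honest framing.  These are shared numerical engines serving client cells; rigour lives in the verifiers (the
soundness theorems below, whose hypotheses are Boolean certificates decided by the kernel); every published number
belongs to a client cell's ledger, not to this module.  ANCHOR / nearest in-tree relatives, deliberately composed
or left unbridged: `TaylorModelZeroCert.lean` (USED: the Newton leaf `newtonLeafCheck` /
`existsUnique_zero_of_newtonLeafCheck` applied to the program `T.deriv p`, `ZClaim`, the generators) and through
it `UnivariateIntervalNewton.lean`; `TaylorModelTangentProgram.lean` (USED: `T.deriv`, `T.guardCheckP`,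
`hasDerivAt_of_guardCheckP`); `GridSupBound.lean` (grid-to-continuum UPPER bounds of `|f|` from a Bernstein-type
derivative hypothesis — bounds only, no extremisers, no certificates; not bridged); `BoxInfeasibility.lean` /
`BoxCover.lean` (kd-tree exclusion certificates for polynomial constraint SYSTEMS over boxes — the exhaustion
principle of interval branch-and-bound for feasibility, not optimisation; not bridged);
`CodeListZeroSearchCertificate.lean` (zero search for expression trees; not bridged).  No module of the tree
states `IsMinOn` / `IsLocalMin` conclusions for program-denoted functions; this one does.  Deliberately NOT here:
degenerate critical points (`Ṗ(z) = P̈(z) = 0`: no leaf certifies them — the generator reports failure, the kernel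
refuses), critical points AT `a` or `b` (a critical-point leaf needs its zero in the interior and a monotonicity
leaf needs `Ṗ ≠ 0` up to the endpoint), non-differentiable programs outside their guards, several variables
(interval branch-and-bound proper: op. cit., Ch. 3–5), and any floating-point arithmetic (all data are exact
rationals and scaled integers).  Problem-independent; no facts, no axioms; all certificate data computable over
`ℚ` and `ℤ`.

References: [cite: RatschekRokne1988, Sect. 3.12]; [cite: RatschekRokne1988, Sect. 3.11]; [cite: RatschekRokne1988, Sect. 3.8 Alg. 2];
[cite: RatschekRokne1988, Sect. 3.2 Alg. 1]; [cite: Moore1979, Sect. 5.2 Thm 5.5–5.6]; [cite: Kearfott1987, Sect. 1];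
[cite: MakinoBerz2003, Algorithm 2]; [cite: GriewankWalther2008, Sect. 3.1 Table 3.4].
-/

open Set

namespace Literature.Analysis.ValidatedNumerics

namespace PolyMP

open Literature.Analysis.ValidatedNumerics.NumericsMP
open Literature.Analysis.ValidatedNumerics.ExpPoly (Poly)
open Literature.Analysis.ValidatedNumerics.ExpPoly
open Literature.Analysis.ValidatedNumerics.IntervalNewton

/-! ### Part A. Variation tables over `ℝ`: rows of strict monotonicity, breakpoints, global extrema -/

/-- **A row of a variation table**: `f` is strictly increasing (`d = true`) or strictly decreasing (`d = false`)
on `[u, v]`. [cite: RatschekRokne1988, Sect. 3.12] -/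
def MonoDir (f : ℝ → ℝ) : Bool → ℝ → ℝ → Prop
  | true, u, v => StrictMonoOn f (Icc u v)
  | false, u, v => StrictAntiOn f (Icc u v)

/-- [cite: RatschekRokne1988, Sect. 3.12] -/
@[simp] theorem monoDir_true (f : ℝ → ℝ) (u v : ℝ) : MonoDir f true u v ↔ StrictMonoOn f (Icc u v) := Iff.rfl

/-- [cite: RatschekRokne1988, Sect. 3.12] -/
@[simp] theorem monoDir_false (f : ℝ → ℝ) (u v : ℝ) : MonoDir f false u v ↔ StrictAntiOn f (Icc u v) := Iff.rfl

/-- **A variation table** from `u`: the rows `(d₁, w₁), (d₂, w₂), …` say `u < w₁ < w₂ < …` and `f` is strictly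
monotone in direction `dᵢ` on `[wᵢ₋₁, wᵢ]` (`w₀ = u`). [cite: RatschekRokne1988, Sect. 3.12] -/
def VarRows (f : ℝ → ℝ) : ℝ → List (Bool × ℝ) → Prop
  | _, [] => True
  | u, r :: R => u < r.2 ∧ MonoDir f r.1 u r.2 ∧ VarRows f r.2 R

/-- The right end of a variation table. [cite: RatschekRokne1988, Sect. 3.12] -/
def rowsEnd : ℝ → List (Bool × ℝ) → ℝ
  | u, [] => u
  | _, r :: R => rowsEnd r.2 R

/-- The breakpoints of a variation table: `u` and the row ends. [cite: RatschekRokne1988, Sect. 3.11] -/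
def bps (u : ℝ) (R : List (Bool × ℝ)) : List ℝ := u :: R.map Prod.snd

/-- [cite: RatschekRokne1988, Sect. 3.12] -/
@[simp] theorem varRows_nil (f : ℝ → ℝ) (u : ℝ) : VarRows f u [] := trivial

/-- [cite: RatschekRokne1988, Sect. 3.12] -/
theorem varRows_cons (f : ℝ → ℝ) (u : ℝ) (r : Bool × ℝ) (R : List (Bool × ℝ)) :
    VarRows f u (r :: R) ↔ u < r.2 ∧ MonoDir f r.1 u r.2 ∧ VarRows f r.2 R := Iff.rfl

/-- [cite: RatschekRokne1988, Sect. 3.12] -/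
@[simp] theorem rowsEnd_nil (u : ℝ) : rowsEnd u [] = u := rfl

/-- [cite: RatschekRokne1988, Sect. 3.12] -/
@[simp] theorem rowsEnd_cons (u : ℝ) (r : Bool × ℝ) (R : List (Bool × ℝ)) : rowsEnd u (r :: R) = rowsEnd r.2 R := rfl

/-- [cite: RatschekRokne1988, Sect. 3.12] -/
theorem rowsEnd_append_singleton : ∀ (u : ℝ) (R : List (Bool × ℝ)) (r : Bool × ℝ), rowsEnd u (R ++ [r]) = r.2
  | _, [], _ => rfl
  | _, _ :: R, r => rowsEnd_append_singleton _ R r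

/-- [cite: RatschekRokne1988, Sect. 3.11] -/
@[simp] theorem bps_cons (u : ℝ) (r : Bool × ℝ) (R : List (Bool × ℝ)) : bps u (r :: R) = u :: bps r.2 R := rfl

/-- [cite: RatschekRokne1988, Sect. 3.11] -/
theorem mem_bps_self (u : ℝ) (R : List (Bool × ℝ)) : u ∈ bps u R := List.mem_cons_self

/-- **Rows of the same direction merge** (`[u, v] ∪ [v, w] = [u, w]`). [cite: RatschekRokne1988, Sect. 3.12] -/
theorem MonoDir.trans {f : ℝ → ℝ} {d : Bool} {u v w : ℝ} (h1 : MonoDir f d u v) (h2 : MonoDir f d v w)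
    (huv : u ≤ v) (hvw : v ≤ w) : MonoDir f d u w := by
  have hg : IsGreatest (Icc u v) v := ⟨right_mem_Icc.2 huv, fun x hx => hx.2⟩
  have hl : IsLeast (Icc v w) v := ⟨left_mem_Icc.2 hvw, fun x hx => hx.1⟩
  cases d
  · simp only [monoDir_false] at h1 h2 ⊢
    have := h1.union h2 hg hl
    rwa [Icc_union_Icc_eq_Icc huv hvw] at this
  · simp only [monoDir_true] at h1 h2 ⊢
    have := h1.union h2 hg hl
    rwa [Icc_union_Icc_eq_Icc huv hvw] at this

namespace VarRows

/-- [cite: RatschekRokne1988, Sect. 3.12] -/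
theorem le_end {f : ℝ → ℝ} : ∀ {u : ℝ} {R : List (Bool × ℝ)}, VarRows f u R → u ≤ rowsEnd u R
  | _, [], _ => le_rfl
  | _, _ :: _, h => h.1.le.trans (le_end h.2.2)

/-- **Gluing two tables whose boundary rows have the same direction.** [cite: RatschekRokne1988, Sect. 3.12] -/
theorem glue {f : ℝ → ℝ} {d : Bool} {m v : ℝ} {R₂ : List (Bool × ℝ)} :
    ∀ {u : ℝ} {R₁ : List (Bool × ℝ)}, VarRows f u (R₁ ++ [(d, m)]) → VarRows f m ((d, v) :: R₂) →
      VarRows f u (R₁ ++ (d, v) :: R₂)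
  | u, [], h1, h2 => by
      simp only [List.nil_append, varRows_cons] at h1 h2 ⊢
      exact ⟨h1.1.trans h2.1, h1.2.1.trans h2.2.1 h1.1.le h2.1.le, h2.2.2⟩
  | u, r :: R₁, h1, h2 => by
      simp only [List.cons_append, varRows_cons] at h1 ⊢
      exact ⟨h1.1, h1.2.1, glue h1.2.2 h2⟩

/-- Breakpoints lie in the domain. [cite: RatschekRokne1988, Sect. 3.11] -/
theorem mem_Icc_of_mem_bps {f : ℝ → ℝ} : ∀ {u : ℝ} {R : List (Bool × ℝ)}, VarRows f u R →
    ∀ w ∈ bps u R, w ∈ Icc u (rowsEnd u R)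
  | u, [], _, w, hw => by
      simp only [bps, List.map_nil, List.mem_singleton] at hw
      subst hw; exact ⟨le_rfl, le_rfl⟩
  | u, r :: R, h, w, hw => by
      rw [bps_cons, List.mem_cons] at hw
      rw [rowsEnd_cons]
      rcases hw with hw | hw
      · subst hw; exact ⟨le_rfl, h.1.le.trans (le_end h.2.2)⟩
      · have := mem_Icc_of_mem_bps h.2.2 w hw
        exact ⟨h.1.le.trans this.1, this.2⟩

/-- **Every value is bounded below by the value at a breakpoint** (piecewise strict monotonicity).
[cite: RatschekRokne1988, Sect. 3.11] -/
theorem exists_bp_le {f : ℝ → ℝ} : ∀ {u : ℝ} {R : List (Bool × ℝ)}, VarRows f u R →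
    ∀ t ∈ Icc u (rowsEnd u R), ∃ w ∈ bps u R, f w ≤ f t
  | u, [], _, t, ht => by
      simp only [rowsEnd_nil] at ht
      exact ⟨u, mem_bps_self u [], by rw [le_antisymm ht.2 ht.1]⟩
  | u, (d, v) :: R, ⟨huv, hm, hr⟩, t, ht => by
      rw [rowsEnd_cons] at ht
      rcases le_or_gt t v with htv | hvt
      · cases d
        · simp only [monoDir_false] at hm
          exact ⟨v, by simp [bps], hm.antitoneOn ⟨ht.1, htv⟩ ⟨huv.le, le_rfl⟩ htv⟩
        · simp only [monoDir_true] at hm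
          exact ⟨u, mem_bps_self _ _, hm.monotoneOn ⟨le_rfl, huv.le⟩ ⟨ht.1, htv⟩ ht.1⟩
      · obtain ⟨w, hw, hle⟩ := exists_bp_le hr t ⟨hvt.le, ht.2⟩
        exact ⟨w, by rw [bps_cons]; exact List.mem_cons_of_mem _ hw, hle⟩

/-- Every value is bounded above by the value at a breakpoint. [cite: RatschekRokne1988, Sect. 3.11] -/
theorem exists_bp_ge {f : ℝ → ℝ} : ∀ {u : ℝ} {R : List (Bool × ℝ)}, VarRows f u R →
    ∀ t ∈ Icc u (rowsEnd u R), ∃ w ∈ bps u R, f t ≤ f w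
  | u, [], _, t, ht => by
      simp only [rowsEnd_nil] at ht
      exact ⟨u, mem_bps_self u [], by rw [le_antisymm ht.2 ht.1]⟩
  | u, (d, v) :: R, ⟨huv, hm, hr⟩, t, ht => by
      rw [rowsEnd_cons] at ht
      rcases le_or_gt t v with htv | hvt
      · cases d
        · simp only [monoDir_false] at hm
          exact ⟨u, mem_bps_self _ _, hm.antitoneOn ⟨le_rfl, huv.le⟩ ⟨ht.1, htv⟩ ht.1⟩
        · simp only [monoDir_true] at hm
          exact ⟨v, by simp [bps], hm.monotoneOn ⟨ht.1, htv⟩ ⟨huv.le, le_rfl⟩ htv⟩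
      · obtain ⟨w, hw, hle⟩ := exists_bp_ge hr t ⟨hvt.le, ht.2⟩
        exact ⟨w, by rw [bps_cons]; exact List.mem_cons_of_mem _ hw, hle⟩

/-- **A global minimiser is a breakpoint** (inside a row `f` is strictly monotone).
[cite: RatschekRokne1988, Sect. 3.11] -/
theorem mem_bps_of_isMinOn {f : ℝ → ℝ} : ∀ {u : ℝ} {R : List (Bool × ℝ)}, VarRows f u R →
    ∀ t ∈ Icc u (rowsEnd u R), IsMinOn f (Icc u (rowsEnd u R)) t → t ∈ bps u R
  | u, [], _, t, ht, _ => by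
      simp only [rowsEnd_nil] at ht
      rw [le_antisymm ht.2 ht.1]; exact mem_bps_self u []
  | u, (d, v) :: R, ⟨huv, hm, hr⟩, t, ht, hmin => by
      rw [rowsEnd_cons] at ht hmin
      rw [bps_cons]
      by_cases htu : t = u
      · rw [htu]; exact List.mem_cons_self
      refine List.mem_cons_of_mem _ ?_
      rcases le_or_gt v t with hvt | htv
      · have h1 := mem_bps_of_isMinOn hr t ⟨hvt, ht.2⟩ (hmin.on_subset (Icc_subset_Icc huv.le le_rfl))
        exact h1
      · exfalso
        have hut : u < t := lt_of_le_of_ne ht.1 (Ne.symm htu)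
        have hvd : v ∈ Icc u (rowsEnd v R) := ⟨huv.le, le_end hr⟩
        have hud : u ∈ Icc u (rowsEnd v R) := ⟨le_rfl, huv.le.trans (le_end hr)⟩
        cases d
        · simp only [monoDir_false] at hm
          have h1 : f v < f t := hm ⟨ht.1, htv.le⟩ ⟨huv.le, le_rfl⟩ htv
          have h2 := isMinOn_iff.1 hmin v hvd
          linarith
        · simp only [monoDir_true] at hm
          have h1 : f u < f t := hm ⟨le_rfl, huv.le⟩ ⟨ht.1, htv.le⟩ hut
          have h2 := isMinOn_iff.1 hmin u hud
          linarith

/-- A global maximiser is a breakpoint. [cite: RatschekRokne1988, Sect. 3.11] -/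
theorem mem_bps_of_isMaxOn {f : ℝ → ℝ} : ∀ {u : ℝ} {R : List (Bool × ℝ)}, VarRows f u R →
    ∀ t ∈ Icc u (rowsEnd u R), IsMaxOn f (Icc u (rowsEnd u R)) t → t ∈ bps u R
  | u, [], _, t, ht, _ => by
      simp only [rowsEnd_nil] at ht
      rw [le_antisymm ht.2 ht.1]; exact mem_bps_self u []
  | u, (d, v) :: R, ⟨huv, hm, hr⟩, t, ht, hmax => by
      rw [rowsEnd_cons] at ht hmax
      rw [bps_cons]
      by_cases htu : t = u
      · rw [htu]; exact List.mem_cons_self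
      refine List.mem_cons_of_mem _ ?_
      rcases le_or_gt v t with hvt | htv
      · exact mem_bps_of_isMaxOn hr t ⟨hvt, ht.2⟩ (hmax.on_subset (Icc_subset_Icc huv.le le_rfl))
      · exfalso
        have hut : u < t := lt_of_le_of_ne ht.1 (Ne.symm htu)
        have hvd : v ∈ Icc u (rowsEnd v R) := ⟨huv.le, le_end hr⟩
        have hud : u ∈ Icc u (rowsEnd v R) := ⟨le_rfl, huv.le.trans (le_end hr)⟩
        cases d
        · simp only [monoDir_false] at hm
          have h1 : f t < f u := hm ⟨le_rfl, huv.le⟩ ⟨ht.1, htv.le⟩ hut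
          have h2 := isMaxOn_iff.1 hmax u hud
          linarith
        · simp only [monoDir_true] at hm
          have h1 : f t < f v := hm ⟨ht.1, htv.le⟩ ⟨huv.le, le_rfl⟩ htv
          have h2 := isMaxOn_iff.1 hmax v hvd
          linarith

/-- **A global minimiser exists, among the breakpoints** (no compactness: the finitely many breakpoint values).
[cite: RatschekRokne1988, Sect. 3.11] -/
theorem exists_isMinOn_bps {f : ℝ → ℝ} {u : ℝ} {R : List (Bool × ℝ)} (hR : VarRows f u R) :
    ∃ w ∈ bps u R, IsMinOn f (Icc u (rowsEnd u R)) w := by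
  obtain ⟨w, hw, hmin⟩ := (bps u R).toFinset.exists_min_image f ⟨u, List.mem_toFinset.2 (mem_bps_self u R)⟩
  refine ⟨w, List.mem_toFinset.1 hw, isMinOn_iff.2 fun t ht => ?_⟩
  obtain ⟨w', hw', hle⟩ := hR.exists_bp_le t ht
  exact (hmin w' (List.mem_toFinset.2 hw')).trans hle

/-- A global maximiser exists, among the breakpoints. [cite: RatschekRokne1988, Sect. 3.11] -/
theorem exists_isMaxOn_bps {f : ℝ → ℝ} {u : ℝ} {R : List (Bool × ℝ)} (hR : VarRows f u R) :
    ∃ w ∈ bps u R, IsMaxOn f (Icc u (rowsEnd u R)) w := by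
  obtain ⟨w, hw, hmax⟩ := (bps u R).toFinset.exists_max_image f ⟨u, List.mem_toFinset.2 (mem_bps_self u R)⟩
  refine ⟨w, List.mem_toFinset.1 hw, isMaxOn_iff.2 fun t ht => ?_⟩
  obtain ⟨w', hw', hle⟩ := hR.exists_bp_ge t ht
  exact hle.trans (hmax w' (List.mem_toFinset.2 hw'))

/-- **Local minimum at a decreasing-then-increasing breakpoint**, local maximum at an increasing-then-decreasing
one. [cite: RatschekRokne1988, Sect. 3.11] -/
theorem isLocalExtr_of_flip {f : ℝ → ℝ} : ∀ {u : ℝ} {R : List (Bool × ℝ)}, VarRows f u R →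
    ∀ q ∈ R.zip R.tail, (q.1.1 = false → q.2.1 = true → IsLocalMin f q.1.2) ∧
      (q.1.1 = true → q.2.1 = false → IsLocalMax f q.1.2)
  | _, [], _, q, hq => by simp at hq
  | _, [_], _, q, hq => by simp at hq
  | u, (d₁, z) :: (d₂, w) :: R, ⟨huz, hm₁, hzw, hm₂, hr⟩, q, hq => by
      rw [List.tail_cons, List.zip_cons_cons, List.mem_cons] at hq
      rcases hq with hq | hq
      · subst hq
        dsimp only
        have hn : Icc u w ∈ nhds z := Icc_mem_nhds huz hzw
        constructor
        · rintro rfl rfl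
          simp only [monoDir_false, monoDir_true] at hm₁ hm₂
          refine Filter.eventually_of_mem hn fun y hy => ?_
          rcases le_total y z with hyz | hzy
          · exact hm₁.antitoneOn ⟨hy.1, hyz⟩ ⟨huz.le, le_rfl⟩ hyz
          · exact hm₂.monotoneOn ⟨le_rfl, hzw.le⟩ ⟨hzy, hy.2⟩ hzy
        · rintro rfl rfl
          simp only [monoDir_false, monoDir_true] at hm₁ hm₂
          refine Filter.eventually_of_mem hn fun y hy => ?_
          rcases le_total y z with hyz | hzy
          · exact hm₁.monotoneOn ⟨hy.1, hyz⟩ ⟨huz.le, le_rfl⟩ hyz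
          · exact hm₂.antitoneOn ⟨le_rfl, hzw.le⟩ ⟨hzy, hy.2⟩ hzy
      · exact isLocalExtr_of_flip (u := z) (R := (d₂, w) :: R) ⟨hzw, hm₂, hr⟩ q hq

end VarRows

/-- **Strict increase from a positive derivative** on the interior, given the derivative on the closed interval
(continuity at the ends). [cite: RatschekRokne1988, Sect. 3.12] -/
theorem strictMonoOn_of_hasDerivAt_pos {f g : ℝ → ℝ} {u v : ℝ} (hd : ∀ t ∈ Icc u v, HasDerivAt f (g t) t)
    (hs : ∀ t ∈ Ioo u v, 0 < g t) : StrictMonoOn f (Icc u v) := by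
  have hc : ContinuousOn f (Icc u v) := fun t ht => (hd t ht).continuousAt.continuousWithinAt
  refine strictMonoOn_of_deriv_pos (convex_Icc u v) hc fun t ht => ?_
  rw [interior_Icc] at ht
  rw [(hd t (Ioo_subset_Icc_self ht)).deriv]
  exact hs t ht

/-- Strict decrease from a negative derivative on the interior. [cite: RatschekRokne1988, Sect. 3.12] -/
theorem strictAntiOn_of_hasDerivAt_neg {f g : ℝ → ℝ} {u v : ℝ} (hd : ∀ t ∈ Icc u v, HasDerivAt f (g t) t)
    (hs : ∀ t ∈ Ioo u v, g t < 0) : StrictAntiOn f (Icc u v) := by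
  have hc : ContinuousOn f (Icc u v) := fun t ht => (hd t ht).continuousAt.continuousWithinAt
  refine strictAntiOn_of_deriv_neg (convex_Icc u v) hc fun t ht => ?_
  rw [interior_Icc] at ht
  rw [(hd t (Ioo_subset_Icc_self ht)).deriv]
  exact hs t ht

/-! #### Candidate values at the breakpoints and the global extrema -/

/-- **A candidate**: a box `[blo, bhi]` claimed to contain a breakpoint `w`, and a scaled enclosure
`vlo ≤ f(w)·S ≤ vhi` of the value there. [cite: RatschekRokne1988, Sect. 3.8 Alg. 2] -/
structure BVal : Type where
  /-- lower end of the location box -/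
  blo : ℚ
  /-- upper end of the location box -/
  bhi : ℚ
  /-- scaled lower bound of the value -/
  vlo : ℤ
  /-- scaled upper bound of the value -/
  vhi : ℤ
  deriving Repr, Inhabited, DecidableEq

namespace BVal

/-- The location box of a candidate. [cite: RatschekRokne1988, Sect. 3.8 Alg. 2] -/
def box (v : BVal) : ℚ × ℚ := (v.blo, v.bhi)

/-- The candidate `v` is CORRECT for the breakpoint `w`: `w` in the box, `f(w)·S` in the value enclosure.
[cite: RatschekRokne1988, Sect. 3.8 Alg. 2] -/
def ok (S : ℕ) (f : ℝ → ℝ) (w : ℝ) (v : BVal) : Prop :=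
  (((v.blo : ℚ) : ℝ) ≤ w ∧ w ≤ ((v.bhi : ℚ) : ℝ)) ∧ ((v.vlo : ℝ) ≤ f w * S ∧ f w * S ≤ (v.vhi : ℝ))

end BVal

/-- Minimum of a list of integers (`0` for the empty list). [folklore] -/
private def lmin : List ℤ → ℤ
  | [] => 0
  | [a] => a
  | a :: b :: l => min a (lmin (b :: l))

/-- Maximum of a list of integers (`0` for the empty list). [folklore] -/
private def lmax : List ℤ → ℤ
  | [] => 0
  | [a] => a
  | a :: b :: l => max a (lmax (b :: l))

/-- [folklore] -/
private theorem lmin_le : ∀ {l : List ℤ} {x : ℤ}, x ∈ l → lmin l ≤ x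
  | [a], x, hx => by simp only [List.mem_singleton] at hx; simp [lmin, hx]
  | a :: b :: l, x, hx => by
      rw [lmin]
      rcases List.mem_cons.1 hx with hx | hx
      · rw [hx]; exact min_le_left _ _
      · exact (min_le_right _ _).trans (lmin_le hx)

/-- [folklore] -/
private theorem lmin_mem : ∀ {l : List ℤ}, l ≠ [] → lmin l ∈ l
  | [a], _ => by simp [lmin]
  | a :: b :: l, _ => by
      rw [lmin]
      rcases min_choice a (lmin (b :: l)) with h | h
      · rw [h]; exact List.mem_cons_self
      · rw [h]; exact List.mem_cons_of_mem _ (lmin_mem (List.cons_ne_nil b l))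

/-- [folklore] -/
private theorem le_lmax : ∀ {l : List ℤ} {x : ℤ}, x ∈ l → x ≤ lmax l
  | [a], x, hx => by simp only [List.mem_singleton] at hx; simp [lmax, hx]
  | a :: b :: l, x, hx => by
      rw [lmax]
      rcases List.mem_cons.1 hx with hx | hx
      · rw [hx]; exact le_max_left _ _
      · exact (le_lmax hx).trans (le_max_right _ _)

/-- [folklore] -/
private theorem lmax_mem : ∀ {l : List ℤ}, l ≠ [] → lmax l ∈ l
  | [a], _ => by simp [lmax]
  | a :: b :: l, _ => by
      rw [lmax]
      rcases max_choice a (lmax (b :: l)) with h | h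
      · rw [h]; exact List.mem_cons_self
      · rw [h]; exact List.mem_cons_of_mem _ (lmax_mem (List.cons_ne_nil b l))

/-- Scaled lower bound of the MINIMUM value: the least candidate lower bound. [cite: RatschekRokne1988, Sect. 3.8 Alg. 2] -/
def minLo (V : List BVal) : ℤ := lmin (V.map BVal.vlo)

/-- Scaled upper bound of the minimum value: the least candidate upper bound. [cite: RatschekRokne1988, Sect. 3.8 Alg. 2] -/
def minHi (V : List BVal) : ℤ := lmin (V.map BVal.vhi)

/-- Scaled lower bound of the MAXIMUM value: the greatest candidate lower bound. [cite: RatschekRokne1988, Sect. 3.8 Alg. 2] -/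
def maxLo (V : List BVal) : ℤ := lmax (V.map BVal.vlo)

/-- Scaled upper bound of the maximum value: the greatest candidate upper bound. [cite: RatschekRokne1988, Sect. 3.8 Alg. 2] -/
def maxHi (V : List BVal) : ℤ := lmax (V.map BVal.vhi)

/-- **The surviving minimiser boxes** (midpoint test): the candidates whose lower bound does not exceed the least
upper bound. [cite: RatschekRokne1988, Sect. 3.8 Alg. 2] -/
def minSurv (V : List BVal) : List (ℚ × ℚ) := (V.filter fun v => decide (v.vlo ≤ minHi V)).map BVal.box

/-- **The surviving maximiser boxes**: the candidates whose upper bound reaches the greatest lower bound.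
[cite: RatschekRokne1988, Sect. 3.8 Alg. 2] -/
def maxSurv (V : List BVal) : List (ℚ × ℚ) := (V.filter fun v => decide (maxLo V ≤ v.vhi)).map BVal.box

/-- [folklore] -/
private theorem forall₂_mem_zip_left {α β : Type} {P : α → β → Prop} :
    ∀ {l₁ : List α} {l₂ : List β}, List.Forall₂ P l₁ l₂ → ∀ a ∈ l₁, ∃ b, (a, b) ∈ l₁.zip l₂ ∧ P a b
  | _, _, List.Forall₂.nil, a, ha => by simp at ha
  | _ :: l₁, _ :: l₂, List.Forall₂.cons h hT, a, ha => by
      rcases List.mem_cons.1 ha with rfl | ha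
      · exact ⟨_, List.mem_cons_self, h⟩
      · obtain ⟨b, hb, hP⟩ := forall₂_mem_zip_left hT a ha
        exact ⟨b, List.mem_cons_of_mem _ hb, hP⟩

/-- [folklore] -/
private theorem forall₂_mem_zip_right {α β : Type} {P : α → β → Prop} :
    ∀ {l₁ : List α} {l₂ : List β}, List.Forall₂ P l₁ l₂ → ∀ b ∈ l₂, ∃ a, (a, b) ∈ l₁.zip l₂ ∧ P a b
  | _, _, List.Forall₂.nil, b, hb => by simp at hb
  | _ :: l₁, _ :: l₂, List.Forall₂.cons h hT, b, hb => by
      rcases List.mem_cons.1 hb with rfl | hb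
      · exact ⟨_, List.mem_cons_self, h⟩
      · obtain ⟨a, ha, hP⟩ := forall₂_mem_zip_right hT b hb
        exact ⟨a, List.mem_cons_of_mem _ ha, hP⟩

/-- [folklore] -/
private theorem zip_filter_singleton {α β : Type} {g : β → Bool} {l₁ : List α} {l₂ : List β} {b₀ : β}
    (hlen : l₁.length = l₂.length) (h : l₂.filter g = [b₀]) :
    ∃ a₀, (l₁.zip l₂).filter (fun z => g z.2) = [(a₀, b₀)] := by
  have hZ : (l₁.zip l₂).map Prod.snd = l₂ := List.map_snd_zip (le_of_eq hlen.symm)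
  have h1 : ((l₁.zip l₂).filter (fun z => g z.2)).map Prod.snd = l₂.filter g := by
    conv_rhs => rw [← hZ, List.filter_map]
    rfl
  rw [h] at h1
  obtain ⟨z, l, hz, hzb, hl⟩ := List.map_eq_cons_iff.1 h1
  rw [List.map_eq_nil_iff] at hl
  refine ⟨z.1, ?_⟩
  rw [hz, hl, ← hzb]

namespace VarRows

variable {S : ℕ} {f : ℝ → ℝ} {u : ℝ} {R : List (Bool × ℝ)} {V : List BVal}

/-- **Lower bound of the global minimum**: every value is at least `minLo/S`. [cite: RatschekRokne1988, Sect. 3.2 Alg. 1] -/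
theorem minLo_le (hR : VarRows f u R) (hV : List.Forall₂ (BVal.ok S f) (bps u R) V) :
    ∀ t ∈ Icc u (rowsEnd u R), ((minLo V : ℤ) : ℝ) ≤ f t * S := by
  intro t ht
  obtain ⟨w, hw, hle⟩ := hR.exists_bp_le t ht
  obtain ⟨v, hz, hok⟩ := forall₂_mem_zip_left hV w hw
  have hv : v ∈ V := (List.of_mem_zip hz).2
  have h1 : minLo V ≤ v.vlo := lmin_le (List.mem_map.2 ⟨v, hv, rfl⟩)
  have h1' : ((minLo V : ℤ) : ℝ) ≤ v.vlo := by exact_mod_cast h1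
  have hS : (0 : ℝ) ≤ S := by positivity
  exact h1'.trans (hok.2.1.trans (mul_le_mul_of_nonneg_right hle hS))

/-- **Upper bound of the global minimum**: some value is at most `minHi/S`. [cite: RatschekRokne1988, Sect. 3.2 Alg. 1] -/
theorem exists_le_minHi (hR : VarRows f u R) (hV : List.Forall₂ (BVal.ok S f) (bps u R) V) :
    ∃ t ∈ Icc u (rowsEnd u R), f t * S ≤ ((minHi V : ℤ) : ℝ) := by
  have hne : V.map BVal.vhi ≠ [] := by
    intro h
    rw [List.map_eq_nil_iff] at h
    have := hV.length_eq
    rw [h] at this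
    simp [bps] at this
  obtain ⟨v, hv, hvhi⟩ := List.mem_map.1 (lmin_mem hne)
  obtain ⟨w, hz, hok⟩ := forall₂_mem_zip_right hV v hv
  have hw : w ∈ bps u R := (List.of_mem_zip hz).1
  refine ⟨w, hR.mem_Icc_of_mem_bps w hw, ?_⟩
  rw [minHi, ← hvhi]
  exact hok.2.2

/-- [folklore] -/
private theorem surv_of_isMinOn (hR : VarRows f u R) (hV : List.Forall₂ (BVal.ok S f) (bps u R) V) {t : ℝ}
    (ht : t ∈ Icc u (rowsEnd u R)) (hmin : IsMinOn f (Icc u (rowsEnd u R)) t) :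
    ∃ v, (t, v) ∈ (bps u R).zip V ∧ v.ok S f t ∧ v.vlo ≤ minHi V := by
  obtain ⟨v, hz, hok⟩ := forall₂_mem_zip_left hV t (hR.mem_bps_of_isMinOn t ht hmin)
  refine ⟨v, hz, hok, ?_⟩
  obtain ⟨t', ht', hle⟩ := hR.exists_le_minHi hV
  have hS : (0 : ℝ) ≤ S := by positivity
  have h1 : f t * S ≤ f t' * S := mul_le_mul_of_nonneg_right (isMinOn_iff.1 hmin t' ht') hS
  have h2 : (v.vlo : ℝ) ≤ ((minHi V : ℤ) : ℝ) := hok.2.1.trans (h1.trans hle)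
  exact_mod_cast h2

/-- **Every global minimiser lies in a surviving box.** [cite: RatschekRokne1988, Sect. 3.8 Alg. 2] -/
theorem minSurv_of_isMinOn (hR : VarRows f u R) (hV : List.Forall₂ (BVal.ok S f) (bps u R) V) :
    ∀ t ∈ Icc u (rowsEnd u R), IsMinOn f (Icc u (rowsEnd u R)) t →
      ∃ e ∈ minSurv V, ((e.1 : ℚ) : ℝ) ≤ t ∧ t ≤ ((e.2 : ℚ) : ℝ) := by
  intro t ht hmin
  obtain ⟨v, hz, hok, hs⟩ := surv_of_isMinOn hR hV ht hmin
  refine ⟨v.box, List.mem_map.2 ⟨v, List.mem_filter.2 ⟨(List.of_mem_zip hz).2, decide_eq_true hs⟩, rfl⟩, hok.1⟩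

/-- **Exactly one global minimiser when exactly one box survives**, and it lies in that box.
[cite: RatschekRokne1988, Sect. 3.8 Alg. 2] [cite: RatschekRokne1988, Sect. 3.11] -/
theorem existsUnique_isMinOn (hR : VarRows f u R) (hV : List.Forall₂ (BVal.ok S f) (bps u R) V) {e : ℚ × ℚ}
    (he : minSurv V = [e]) :
    (∃! t, t ∈ Icc u (rowsEnd u R) ∧ IsMinOn f (Icc u (rowsEnd u R)) t) ∧
      ∀ t ∈ Icc u (rowsEnd u R), IsMinOn f (Icc u (rowsEnd u R)) t → ((e.1 : ℚ) : ℝ) ≤ t ∧ t ≤ ((e.2 : ℚ) : ℝ) := by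
  obtain ⟨v₀, l, hv₀, -, hl⟩ := List.map_eq_cons_iff.1 he
  rw [List.map_eq_nil_iff] at hl
  rw [hl] at hv₀
  obtain ⟨w₀, hw₀⟩ := zip_filter_singleton hV.length_eq hv₀
  have huniq : ∀ t ∈ Icc u (rowsEnd u R), IsMinOn f (Icc u (rowsEnd u R)) t → t = w₀ := by
    intro t ht hmin
    obtain ⟨v, hz, -, hs⟩ := surv_of_isMinOn hR hV ht hmin
    have h1 : (t, v) ∈ ((bps u R).zip V).filter (fun z => decide (z.2.vlo ≤ minHi V)) :=
      List.mem_filter.2 ⟨hz, decide_eq_true hs⟩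
    rw [hw₀, List.mem_singleton] at h1
    exact (Prod.mk.inj h1).1
  refine ⟨?_, fun t ht hmin => ?_⟩
  · obtain ⟨w, hw, hmin⟩ := hR.exists_isMinOn_bps
    have hwd := hR.mem_Icc_of_mem_bps w hw
    exact ⟨w, ⟨hwd, hmin⟩, fun t ht => (huniq t ht.1 ht.2).trans (huniq w hwd hmin).symm⟩
  · obtain ⟨e', he', h⟩ := hR.minSurv_of_isMinOn hV t ht hmin
    rw [he, List.mem_singleton] at he'
    rw [he'] at h
    exact h

/-- **Upper bound of the global maximum**: every value is at most `maxHi/S`. [cite: RatschekRokne1988, Sect. 3.2 Alg. 1] -/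
theorem le_maxHi (hR : VarRows f u R) (hV : List.Forall₂ (BVal.ok S f) (bps u R) V) :
    ∀ t ∈ Icc u (rowsEnd u R), f t * S ≤ ((maxHi V : ℤ) : ℝ) := by
  intro t ht
  obtain ⟨w, hw, hle⟩ := hR.exists_bp_ge t ht
  obtain ⟨v, hz, hok⟩ := forall₂_mem_zip_left hV w hw
  have hv : v ∈ V := (List.of_mem_zip hz).2
  have h1 : v.vhi ≤ maxHi V := le_lmax (List.mem_map.2 ⟨v, hv, rfl⟩)
  have h1' : (v.vhi : ℝ) ≤ ((maxHi V : ℤ) : ℝ) := by exact_mod_cast h1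
  have hS : (0 : ℝ) ≤ S := by positivity
  exact ((mul_le_mul_of_nonneg_right hle hS).trans hok.2.2).trans h1'

/-- **Lower bound of the global maximum**: some value is at least `maxLo/S`. [cite: RatschekRokne1988, Sect. 3.2 Alg. 1] -/
theorem exists_maxLo_le (hR : VarRows f u R) (hV : List.Forall₂ (BVal.ok S f) (bps u R) V) :
    ∃ t ∈ Icc u (rowsEnd u R), ((maxLo V : ℤ) : ℝ) ≤ f t * S := by
  have hne : V.map BVal.vlo ≠ [] := by
    intro h
    rw [List.map_eq_nil_iff] at h
    have := hV.length_eq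
    rw [h] at this
    simp [bps] at this
  obtain ⟨v, hv, hvlo⟩ := List.mem_map.1 (lmax_mem hne)
  obtain ⟨w, hz, hok⟩ := forall₂_mem_zip_right hV v hv
  have hw : w ∈ bps u R := (List.of_mem_zip hz).1
  refine ⟨w, hR.mem_Icc_of_mem_bps w hw, ?_⟩
  rw [maxLo, ← hvlo]
  exact hok.2.1

/-- [folklore] -/
private theorem surv_of_isMaxOn (hR : VarRows f u R) (hV : List.Forall₂ (BVal.ok S f) (bps u R) V) {t : ℝ}
    (ht : t ∈ Icc u (rowsEnd u R)) (hmax : IsMaxOn f (Icc u (rowsEnd u R)) t) :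
    ∃ v, (t, v) ∈ (bps u R).zip V ∧ v.ok S f t ∧ maxLo V ≤ v.vhi := by
  obtain ⟨v, hz, hok⟩ := forall₂_mem_zip_left hV t (hR.mem_bps_of_isMaxOn t ht hmax)
  refine ⟨v, hz, hok, ?_⟩
  obtain ⟨t', ht', hle⟩ := hR.exists_maxLo_le hV
  have hS : (0 : ℝ) ≤ S := by positivity
  have h1 : f t' * S ≤ f t * S := mul_le_mul_of_nonneg_right (isMaxOn_iff.1 hmax t' ht') hS
  have h2 : ((maxLo V : ℤ) : ℝ) ≤ (v.vhi : ℝ) := hle.trans (h1.trans hok.2.2)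
  exact_mod_cast h2

/-- **Every global maximiser lies in a surviving box.** [cite: RatschekRokne1988, Sect. 3.8 Alg. 2] -/
theorem maxSurv_of_isMaxOn (hR : VarRows f u R) (hV : List.Forall₂ (BVal.ok S f) (bps u R) V) :
    ∀ t ∈ Icc u (rowsEnd u R), IsMaxOn f (Icc u (rowsEnd u R)) t →
      ∃ e ∈ maxSurv V, ((e.1 : ℚ) : ℝ) ≤ t ∧ t ≤ ((e.2 : ℚ) : ℝ) := by
  intro t ht hmax
  obtain ⟨v, hz, hok, hs⟩ := surv_of_isMaxOn hR hV ht hmax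
  refine ⟨v.box, List.mem_map.2 ⟨v, List.mem_filter.2 ⟨(List.of_mem_zip hz).2, decide_eq_true hs⟩, rfl⟩, hok.1⟩

/-- **Exactly one global maximiser when exactly one box survives**, and it lies in that box.
[cite: RatschekRokne1988, Sect. 3.8 Alg. 2] [cite: RatschekRokne1988, Sect. 3.11] -/
theorem existsUnique_isMaxOn (hR : VarRows f u R) (hV : List.Forall₂ (BVal.ok S f) (bps u R) V) {e : ℚ × ℚ}
    (he : maxSurv V = [e]) :
    (∃! t, t ∈ Icc u (rowsEnd u R) ∧ IsMaxOn f (Icc u (rowsEnd u R)) t) ∧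
      ∀ t ∈ Icc u (rowsEnd u R), IsMaxOn f (Icc u (rowsEnd u R)) t → ((e.1 : ℚ) : ℝ) ≤ t ∧ t ≤ ((e.2 : ℚ) : ℝ) := by
  obtain ⟨v₀, l, hv₀, -, hl⟩ := List.map_eq_cons_iff.1 he
  rw [List.map_eq_nil_iff] at hl
  rw [hl] at hv₀
  obtain ⟨w₀, hw₀⟩ := zip_filter_singleton hV.length_eq hv₀
  have huniq : ∀ t ∈ Icc u (rowsEnd u R), IsMaxOn f (Icc u (rowsEnd u R)) t → t = w₀ := by
    intro t ht hmax
    obtain ⟨v, hz, -, hs⟩ := surv_of_isMaxOn hR hV ht hmax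
    have h1 : (t, v) ∈ ((bps u R).zip V).filter (fun z => decide (maxLo V ≤ z.2.vhi)) :=
      List.mem_filter.2 ⟨hz, decide_eq_true hs⟩
    rw [hw₀, List.mem_singleton] at h1
    exact (Prod.mk.inj h1).1
  refine ⟨?_, fun t ht hmax => ?_⟩
  · obtain ⟨w, hw, hmax⟩ := hR.exists_isMaxOn_bps
    have hwd := hR.mem_Icc_of_mem_bps w hw
    exact ⟨w, ⟨hwd, hmax⟩, fun t ht => (huniq t ht.1 ht.2).trans (huniq w hwd hmax).symm⟩
  · obtain ⟨e', he', h⟩ := hR.maxSurv_of_isMaxOn hV t ht hmax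
    rw [he, List.mem_singleton] at he'
    rw [he'] at h
    exact h

end VarRows


/-! #### The variation-table claim of a segment, and gluing -/

/-- A row of a table MATCHES its specification: same direction, and the candidate data of the critical point
ending the row are correct. [cite: RatschekRokne1988, Sect. 3.11] -/
def RowOK (S : ℕ) (f : ℝ → ℝ) (r : Bool × ℝ) (k : Bool × BVal) : Prop :=
  r.1 = k.1 ∧ k.2.ok S f r.2

/-- **The variation-table claim** for `f` with derivative `f'` on `[x, y]` against the specification `K` (the rows
ending at critical points, with their candidate data) and the final direction `e`: there are rows `R` matching
`K`, `f` follows the table `R ++ [(e, y)]` from `x`, and the zeros of `f'` on `[x, y]` ARE the row ends of `R`.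
[cite: RatschekRokne1988, Sect. 3.11] [cite: RatschekRokne1988, Sect. 3.12] -/
def ETable (S : ℕ) (f f' : ℝ → ℝ) (x y : ℚ) (K : List (Bool × BVal)) (e : Bool) : Prop :=
  ∃ R : List (Bool × ℝ), List.Forall₂ (RowOK S f) R K ∧ VarRows f ((x : ℚ) : ℝ) (R ++ [(e, ((y : ℚ) : ℝ))]) ∧
    ∀ t : ℝ, (t ∈ Icc ((x : ℚ) : ℝ) ((y : ℚ) : ℝ) ∧ f' t = 0) ↔ t ∈ R.map Prod.snd

/-- The direction of the first row of a table with specification `K` and final direction `e`.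
[cite: RatschekRokne1988, Sect. 3.12] -/
def firstDir : List (Bool × BVal) → Bool → Bool
  | [], e => e
  | k :: _, _ => k.1

/-- [folklore] -/
private theorem forall₂_append' {α β : Type} {P : α → β → Prop} :
    ∀ {l₁ : List α} {l₂ : List β} {l₃ : List α} {l₄ : List β},
      List.Forall₂ P l₁ l₂ → List.Forall₂ P l₃ l₄ → List.Forall₂ P (l₁ ++ l₃) (l₂ ++ l₄)
  | _, _, _, _, List.Forall₂.nil, h => h
  | _, _, _, _, List.Forall₂.cons h1 h2, h => List.Forall₂.cons h1 (forall₂_append' h2 h)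

namespace ETable

/-- **Gluing** the table claims on `[x, m]` and `[m, y]` when the final direction of the first is the first
direction of the second (the boundary rows merge). [cite: RatschekRokne1988, Sect. 3.12] -/
theorem append {S : ℕ} {f f' : ℝ → ℝ} {x m y : ℚ} {K₁ K₂ : List (Bool × BVal)} {e₁ e₂ : Bool} (hxm : x ≤ m)
    (hmy : m ≤ y) (h₁ : ETable S f f' x m K₁ e₁) (h₂ : ETable S f f' m y K₂ e₂) (hd : firstDir K₂ e₂ = e₁) :
    ETable S f f' x y (K₁ ++ K₂) e₂ := by
  obtain ⟨R₁, hF₁, hV₁, hiff₁⟩ := h₁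
  obtain ⟨R₂, hF₂, hV₂, hiff₂⟩ := h₂
  have hxm' : ((x : ℚ) : ℝ) ≤ ((m : ℚ) : ℝ) := by exact_mod_cast hxm
  have hmy' : ((m : ℚ) : ℝ) ≤ ((y : ℚ) : ℝ) := by exact_mod_cast hmy
  have hhead : ∃ v rest, R₂ ++ [(e₂, ((y : ℚ) : ℝ))] = (e₁, v) :: rest := by
    cases hF₂ with
    | nil =>
        simp only [firstDir] at hd
        exact ⟨_, [], by rw [hd]; rfl⟩
    | @cons r k R₂' K₂' hk _ =>
        simp only [firstDir] at hd
        refine ⟨r.2, R₂' ++ [(e₂, ((y : ℚ) : ℝ))], ?_⟩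
        rw [List.cons_append, ← hd, ← hk.1]
  obtain ⟨v, rest, he⟩ := hhead
  refine ⟨R₁ ++ R₂, forall₂_append' hF₁ hF₂, ?_, fun t => ?_⟩
  · rw [List.append_assoc, he]
    rw [he] at hV₂
    exact hV₁.glue hV₂
  · rw [List.map_append, List.mem_append, ← hiff₁ t, ← hiff₂ t]
    constructor
    · rintro ⟨⟨ht1, ht2⟩, hft⟩
      rcases le_total t ((m : ℚ) : ℝ) with htm | htm
      · exact Or.inl ⟨⟨ht1, htm⟩, hft⟩
      · exact Or.inr ⟨⟨htm, ht2⟩, hft⟩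
    · rintro (⟨⟨ht1, ht2⟩, hft⟩ | ⟨⟨ht1, ht2⟩, hft⟩)
      · exact ⟨⟨ht1, ht2.trans hmy'⟩, hft⟩
      · exact ⟨⟨hxm'.trans ht1, ht2⟩, hft⟩

/-- The rows of a table claim, with their values: `f` follows `R ++ [(e, y)]` from `x` and the candidates
`Vx :: K-values ++ [Vy]` are correct at the breakpoints `x :: row ends ++ [y]`. [cite: RatschekRokne1988, Sect. 3.11] -/
theorem rows {S : ℕ} {f f' : ℝ → ℝ} {x y : ℚ} {K : List (Bool × BVal)} {e : Bool} (h : ETable S f f' x y K e)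
    {Vx Vy : BVal} (hx : Vx.ok S f ((x : ℚ) : ℝ)) (hy : Vy.ok S f ((y : ℚ) : ℝ)) :
    ∃ R' : List (Bool × ℝ), VarRows f ((x : ℚ) : ℝ) R' ∧ rowsEnd ((x : ℚ) : ℝ) R' = ((y : ℚ) : ℝ) ∧
      List.Forall₂ (BVal.ok S f) (bps ((x : ℚ) : ℝ) R') (Vx :: (K.map Prod.snd ++ [Vy])) := by
  obtain ⟨R, hF, hV, -⟩ := h
  refine ⟨R ++ [(e, ((y : ℚ) : ℝ))], hV, rowsEnd_append_singleton _ _ _, ?_⟩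
  rw [bps, List.map_append, List.map_cons, List.map_nil]
  refine List.Forall₂.cons hx (forall₂_append' ?_ (List.Forall₂.cons hy List.Forall₂.nil))
  rw [List.forall₂_map_left_iff, List.forall₂_map_right_iff]
  exact hF.imp fun r k hrk => hrk.2

end ETable

/-! ### Part B. Leaves: monotonicity leaves and critical-point leaves on `[c − h, c + h]` -/

/-- **The kind of a leaf** of an extrema certificate: `inc` / `dec` — `P(ps; ·)` strictly increasing / decreasing
on the leaf (monotonicity test `0 ∉ F′(X)`); `lmin zlo zhi` / `lmax zlo zhi` — exactly one critical point on the
leaf, a strict local minimum / maximum, inside the claimed enclosure `[zlo, zhi]` (interval Newton on `f′`).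
[cite: RatschekRokne1988, Sect. 3.12] [cite: RatschekRokne1988, Sect. 3.11] -/
inductive EKind : Type
  | inc : EKind
  | dec : EKind
  | lmin (zlo zhi : ℚ) : EKind
  | lmax (zlo zhi : ℚ) : EKind
  deriving Repr, Inhabited, DecidableEq

namespace EKind

/-- Direction of `P(ps; ·)` at the LEFT end of the leaf (`true` = increasing). [cite: RatschekRokne1988, Sect. 3.12] -/
def entry : EKind → Bool
  | inc => true
  | dec => false
  | lmin _ _ => false
  | lmax _ _ => true

/-- Direction of `P(ps; ·)` at the RIGHT end of the leaf. [cite: RatschekRokne1988, Sect. 3.12] -/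
def exit : EKind → Bool
  | inc => true
  | dec => false
  | lmin _ _ => true
  | lmax _ _ => false

/-- The claimed enclosure of the critical point of the leaf, if any. [cite: RatschekRokne1988, Sect. 3.11] -/
def encl : EKind → Option (ℚ × ℚ)
  | inc => none
  | dec => none
  | lmin zlo zhi => some (zlo, zhi)
  | lmax zlo zhi => some (zlo, zhi)

end EKind

/-- **A leaf of an extrema certificate**: the interval `[c − h, c + h]`, its kind, and certificate candidates —
`csp`: guard certificate of `p` on the leaf (all kinds); `csq`: model of the tangent program `T.deriv p` on the
leaf (`inc`/`dec`) / its POINT model at `c` (`lmin`/`lmax`); `csd`, `csg`: model of the second tangent program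
`T.deriv (T.deriv p)` and guard certificate of `T.deriv p` on the leaf; `cse`: point model of `T.deriv p` at
`c − h` (the kind test); `csv`: model of `p` on the enclosure box (the critical value) — the last four for
`lmin`/`lmax` only. [cite: RatschekRokne1988, Sect. 3.11] [cite: Kearfott1987, Sect. 1] -/
structure ELeaf : Type where
  /-- centre -/
  c : ℚ
  /-- half-width -/
  h : ℚ
  /-- candidates: guard certificate of `p` -/
  csp : List (List ℤ × ℕ)
  /-- candidates: model / point model of `T.deriv p` -/
  csq : List (List ℤ × ℕ)
  /-- candidates: model of `T.deriv (T.deriv p)` -/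
  csd : List (List ℤ × ℕ)
  /-- candidates: guard certificate of `T.deriv p` -/
  csg : List (List ℤ × ℕ)
  /-- candidates: point model of `T.deriv p` at `c − h` -/
  cse : List (List ℤ × ℕ)
  /-- candidates: model of `p` on the enclosure box -/
  csv : List (List ℤ × ℕ)
  /-- kind of the leaf -/
  kind : EKind
  deriving Repr, Inhabited

/-- The claimed enclosures of the critical points, in order. [cite: RatschekRokne1988, Sect. 3.11] -/
def eEncls : List ELeaf → List (ℚ × ℚ)
  | [] => []
  | l :: L =>
      match l.kind.encl with
      | none => eEncls L
      | some e => e :: eEncls L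

/-- [cite: RatschekRokne1988, Sect. 3.11] -/
theorem eEncls_cons (l : ELeaf) (L : List ELeaf) : eEncls (l :: L) = eEncls [l] ++ eEncls L := by
  simp only [eEncls]
  cases l.kind.encl <;> simp

/-- **Consistency of consecutive leaves**: the exit direction of each leaf is the entry direction of the next.
[cite: RatschekRokne1988, Sect. 3.12] -/
def consistent : List ELeaf → Bool
  | [] => true
  | [_] => true
  | l :: l' :: L => (l.kind.exit == l'.kind.entry) && consistent (l' :: L)

/-- The exit direction of the last leaf (`true` for no leaf). [cite: RatschekRokne1988, Sect. 3.12] -/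
def lastDir : List ELeaf → Bool
  | [] => true
  | [l] => l.kind.exit
  | _ :: l' :: L => lastDir (l' :: L)

namespace OpModel

variable (M : OpModel)

/-- **The candidate data of a critical point** claimed in `[zlo, zhi]`: the box itself and the scaled range bounds
of the model of `p` on the box (centre `(zlo + zhi)/2`, half-width `(zhi − zlo)/2`, candidates `csv`), with the
acceptance flag. [cite: RatschekRokne1988, Sect. 3.11] [cite: MakinoBerz2003, Algorithm 2] -/
def critVal (prm : M.Prm) (S : ℕ) (p : GProg M) (B : PBox) (zlo zhi : ℚ) (csv : List (List ℤ × ℕ)) :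
    BVal × Bool :=
  let W := M.pmodelP prm S ((zhi - zlo) / 2) ((zlo + zhi) / 2) p B csv
  (⟨zlo, zhi, tlowerI S ((zhi - zlo) / 2) W.1, tupperI S ((zhi - zlo) / 2) W.1⟩, decide (zlo ≤ zhi) && W.2)

/-- **The candidate data of an endpoint** `x`: the point box `[x, x]` and the point model value `P(ps; x)·S`, with
the acceptance flag. [cite: RatschekRokne1988, Sect. 3.11] [cite: MakinoBerz2003, Algorithm 2] -/
def endVal (prm : M.Prm) (S : ℕ) (p : GProg M) (B : PBox) (x : ℚ) (cs : List (List ℤ × ℕ)) : BVal × Bool :=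
  let Y := M.pointI prm S p B x cs
  (⟨x, x, Y.1.lo, Y.1.hi⟩, Y.2)

/-- The rows of a leaf that end at a critical point, with their candidate data (none for a monotonicity leaf).
[cite: RatschekRokne1988, Sect. 3.11] -/
def leafRows (prm : M.Prm) (S : ℕ) (p : GProg M) (B : PBox) (l : ELeaf) : List (Bool × BVal) :=
  match l.kind with
  | .inc => []
  | .dec => []
  | .lmin zlo zhi => [(false, (M.critVal prm S p B zlo zhi l.csv).1)]
  | .lmax zlo zhi => [(true, (M.critVal prm S p B zlo zhi l.csv).1)]

/-- The specification of the variation table of a list of leaves: the critical rows in order.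
[cite: RatschekRokne1988, Sect. 3.11] -/
def eSpec (prm : M.Prm) (S : ℕ) (p : GProg M) (B : PBox) : List ELeaf → List (Bool × BVal)
  | [] => []
  | l :: L => M.leafRows prm S p B l ++ eSpec prm S p B L

end OpModel

namespace OpSem

variable {M : OpModel} (F : OpSem M)

/-- **Soundness of the critical-value candidate**: for any point `z` of the box, `z` and `P(ps; z)·S` are enclosed.
[cite: MakinoBerz2003, Algorithm 2] -/
theorem ok_critVal {prm : M.Prm} {S : ℕ} (hS : 0 < S) {p : GProg M} {B : PBox} {zlo zhi : ℚ}
    {csv : List (List ℤ × ℕ)} (hok : (M.critVal prm S p B zlo zhi csv).2 = true) {ps : List ℝ} (hB : BoxMem ps B)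
    {z : ℝ} (hz : ((zlo : ℚ) : ℝ) ≤ z ∧ z ≤ ((zhi : ℚ) : ℝ)) :
    (M.critVal prm S p B zlo zhi csv).1.ok S (F.toFunP p ps) z := by
  unfold OpModel.critVal at hok ⊢
  simp only [Bool.and_eq_true, decide_eq_true_eq] at hok
  obtain ⟨hle, hW⟩ := hok
  have h0 : (0 : ℚ) ≤ (zhi - zlo) / 2 := by linarith
  have hWm := F.tmem_pmodelP prm hS h0 ((zlo + zhi) / 2) p hB csv hW
  have hu : |z - (((zlo + zhi) / 2 : ℚ) : ℝ)| ≤ (((zhi - zlo) / 2 : ℚ) : ℝ) := by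
    push_cast
    exact abs_le.2 ⟨by linarith [hz.1], by linarith [hz.2]⟩
  have h1 := tlowerI_le h0 hWm hu
  have h2 := le_tupperI h0 hWm hu
  have e : (((zlo + zhi) / 2 : ℚ) : ℝ) + (z - (((zlo + zhi) / 2 : ℚ) : ℝ)) = z := by ring
  simp only [e] at h1 h2
  exact ⟨hz, h1, h2⟩

/-- **Soundness of the endpoint candidate**: `P(ps; x)·S` is enclosed. [cite: MakinoBerz2003, Algorithm 2] -/
theorem ok_endVal {prm : M.Prm} {S : ℕ} (hS : 0 < S) {p : GProg M} {B : PBox} {x : ℚ} {cs : List (List ℤ × ℕ)}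
    (hok : (M.endVal prm S p B x cs).2 = true) {ps : List ℝ} (hB : BoxMem ps B) :
    (M.endVal prm S p B x cs).1.ok S (F.toFunP p ps) ((x : ℚ) : ℝ) := by
  unfold OpModel.endVal at hok ⊢
  have h1 := F.mem_pointI hS hok hB
  exact ⟨⟨le_rfl, le_rfl⟩, h1.1, h1.2⟩

end OpSem

namespace OpTangentCore

variable {M : OpModel} (T : OpTangentCore M)

/-- **The monotonicity-leaf certificate** on `X = [c − h, c + h]`: `0 < S`, `0 < h`, the guard certificate of `p`
on `X` (so that `Ṗ` IS the derivative there), the model of the tangent program `T.deriv p` on `X` accepted with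
scaled lower bound `> 0` (`up`: strictly increasing) / upper bound `< 0` (strictly decreasing) — the
monotonicity test `0 ∉ F′(X)`. [cite: RatschekRokne1988, Sect. 3.12] [cite: GriewankWalther2008, Sect. 3.1 Table 3.4] -/
def monoLeafCheck (prm : M.Prm) (S : ℕ) (p : GProg M) (B : PBox) (c h : ℚ) (csp csq : List (List ℤ × ℕ))
    (up : Bool) : Bool :=
  let W := M.pmodelP prm S h c (T.deriv p) B csq
  decide (0 < S) && decide (0 < h) && T.guardCheckP prm S h c p B csp && W.2 &&
    (bif up then decide (0 < tlowerI S h W.1) else decide (tupperI S h W.1 < 0))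

/-- **The critical-point-leaf certificate** on `X = [c − h, c + h]` with claimed enclosure `[zlo, zhi]` and kind
`isMin`: the guard certificate of `p` on `X`; the point model of `T.deriv p` at `c − h` with `Ṗ(ps; c − h) < 0`
(`isMin`: decreasing on entry) / `> 0`; the critical-value candidate accepted; and the interval Newton leaf for the
PROGRAM `T.deriv p` (`T.newtonLeafCheck`: exactly one zero of `Ṗ(ps; ·)` on `X`, inside `[zlo, zhi]`, with
`0 ∉ F″(X)` from the model of `T.deriv (T.deriv p)`). [cite: RatschekRokne1988, Sect. 3.11] [cite: Moore1979, Sect. 5.2 Thm 5.5–5.6] -/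
def critLeafCheck (prm : M.Prm) (S : ℕ) (p : GProg M) (B : PBox) (c h : ℚ)
    (csp csq csd csg cse csv : List (List ℤ × ℕ)) (isMin : Bool) (zlo zhi : ℚ) : Bool :=
  let E := M.pointI prm S (T.deriv p) B (c - h) cse
  T.guardCheckP prm S h c p B csp && E.2 && (bif isMin then decide (E.1.hi < 0) else decide (0 < E.1.lo)) &&
    (M.critVal prm S p B zlo zhi csv).2 && T.newtonLeafCheck prm S (T.deriv p) B c h csq csd csg zlo zhi

/-- **The leaf certificate** by kind. [cite: RatschekRokne1988, Sect. 3.11] [cite: RatschekRokne1988, Sect. 3.12] -/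
def eLeafCheck (prm : M.Prm) (S : ℕ) (p : GProg M) (B : PBox) (l : ELeaf) : Bool :=
  match l.kind with
  | .inc => T.monoLeafCheck prm S p B l.c l.h l.csp l.csq true
  | .dec => T.monoLeafCheck prm S p B l.c l.h l.csp l.csq false
  | .lmin zlo zhi => T.critLeafCheck prm S p B l.c l.h l.csp l.csq l.csd l.csg l.cse l.csv true zlo zhi
  | .lmax zlo zhi => T.critLeafCheck prm S p B l.c l.h l.csp l.csq l.csd l.csg l.cse l.csv false zlo zhi

/-- All leaves pass. [cite: Kearfott1987, Sect. 1] -/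
def eLeavesCheck (prm : M.Prm) (S : ℕ) (p : GProg M) (B : PBox) : List ELeaf → Bool
  | [] => true
  | l :: L => T.eLeafCheck prm S p B l && eLeavesCheck prm S p B L

end OpTangentCore

/-! #### Soundness of the leaves -/

/-- [folklore] -/
private theorem neg_of_mul_natCast_le {x b : ℝ} {S : ℕ} (h : x * S ≤ b) (hb : b < 0) : x < 0 := by
  rcases lt_or_ge x 0 with hx | hx
  · exact hx
  · have : (0 : ℝ) ≤ x * S := mul_nonneg hx (by positivity)
    linarith

namespace OpTangent

variable {M : OpModel} {F : OpSem M} (T : OpTangent M F)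

/-- **Strict monotonicity on a Newton leaf**: the derivative enclosure `0 ∉ F′(X)` inside an accepted Newton leaf
makes `P(ps; ·)` strictly increasing or strictly decreasing on the leaf.
[cite: Moore1979, Sect. 5.2 Thm 5.5–5.6] [cite: RatschekRokne1988, Sect. 3.12] -/
theorem strictMonoOn_or_strictAntiOn_of_newtonLeafCheck {prm : M.Prm} {S : ℕ} {p : GProg M} {B : PBox}
    {c h : ℚ} {cs0 csd csg : List (List ℤ × ℕ)} {zlo zhi : ℚ}
    (hc : T.newtonLeafCheck prm S p B c h cs0 csd csg zlo zhi = true) {ps : List ℝ} (hB : BoxMem ps B) :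
    0 < S ∧ 0 < h ∧ (StrictMonoOn (F.toFunP p ps) (Icc ((c : ℝ) - h) ((c : ℝ) + h)) ∨
      StrictAntiOn (F.toFunP p ps) (Icc ((c : ℝ) - h) ((c : ℝ) + h))) := by
  unfold OpTangentCore.newtonLeafCheck at hc
  simp only [Bool.and_eq_true, Bool.or_eq_true, decide_eq_true_eq] at hc
  obtain ⟨⟨⟨⟨⟨⟨⟨⟨⟨⟨hS, h0⟩, -⟩, hokd⟩, hg⟩, hsgn⟩, -⟩, -⟩, -⟩, -⟩, -⟩ := hc
  refine ⟨hS, h0, ?_⟩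
  have hSr : (0 : ℝ) < S := by exact_mod_cast hS
  have hder := T.hasDerivAt_of_guardCheckP hg hB
  have hWm := F.tmem_pmodelP prm hS h0.le c (T.deriv p) hB csd hokd
  have hD : ∀ t ∈ Icc ((c : ℝ) - h) ((c : ℝ) + h),
      ((tlowerI S h (M.pmodelP prm S h c (T.deriv p) B csd).1 : ℤ) : ℝ) ≤ F.toFunP (T.deriv p) ps t * S ∧
        F.toFunP (T.deriv p) ps t * S ≤ ((tupperI S h (M.pmodelP prm S h c (T.deriv p) B csd).1 : ℤ) : ℝ) := by
    intro t ht
    have hu : |t - c| ≤ (h : ℝ) := abs_le.2 ⟨by linarith [ht.1], by linarith [ht.2]⟩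
    have h1 := tlowerI_le h0.le hWm hu
    have h2 := le_tupperI h0.le hWm hu
    have e : (c : ℝ) + (t - c) = t := by ring
    simp only [e] at h1 h2
    exact ⟨h1, h2⟩
  rcases hsgn with hs | hs
  · left
    refine strictMonoOn_of_hasDerivAt_pos hder fun t ht => ?_
    have h1 := (hD t (Ioo_subset_Icc_self ht)).1
    have hs' : (0 : ℝ) < ((tlowerI S h (M.pmodelP prm S h c (T.deriv p) B csd).1 : ℤ) : ℝ) := by exact_mod_cast hs
    exact (mul_pos_iff_of_pos_right hSr).1 (lt_of_lt_of_le hs' h1)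
  · right
    refine strictAntiOn_of_hasDerivAt_neg hder fun t ht => ?_
    have h2 := (hD t (Ioo_subset_Icc_self ht)).2
    have hs' : ((tupperI S h (M.pmodelP prm S h c (T.deriv p) B csd).1 : ℤ) : ℝ) < 0 := by exact_mod_cast hs
    exact neg_of_mul_natCast_le h2 hs'

/-- **Soundness of the monotonicity leaf**: `Ṗ` is the derivative on the leaf, and the variation table of the leaf
is the single row of direction `up`, with no critical point.
[cite: RatschekRokne1988, Sect. 3.12] [cite: GriewankWalther2008, Sect. 3.1 Table 3.4] -/
theorem sound_of_monoLeafCheck {prm : M.Prm} {S : ℕ} {p : GProg M} {B : PBox} {c h : ℚ}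
    {csp csq : List (List ℤ × ℕ)} {up : Bool} (hc : T.monoLeafCheck prm S p B c h csp csq up = true)
    {ps : List ℝ} (hB : BoxMem ps B) :
    0 < S ∧ 0 < h ∧ (∀ t ∈ Icc ((c : ℝ) - h) ((c : ℝ) + h), HasDerivAt (F.toFunP p ps) (F.toFunP (T.deriv p) ps t) t) ∧
      ETable S (F.toFunP p ps) (F.toFunP (T.deriv p) ps) (c - h) (c + h) [] up := by
  unfold OpTangentCore.monoLeafCheck at hc
  simp only [Bool.and_eq_true, decide_eq_true_eq] at hc
  obtain ⟨⟨⟨⟨hS, h0⟩, hg⟩, hok⟩, hs⟩ := hc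
  have hSr : (0 : ℝ) < S := by exact_mod_cast hS
  have h0r : (0 : ℝ) < h := by exact_mod_cast h0
  have hder := T.hasDerivAt_of_guardCheckP hg hB
  have hWm := F.tmem_pmodelP prm hS h0.le c (T.deriv p) hB csq hok
  have hD : ∀ t ∈ Icc ((c : ℝ) - h) ((c : ℝ) + h),
      ((tlowerI S h (M.pmodelP prm S h c (T.deriv p) B csq).1 : ℤ) : ℝ) ≤ F.toFunP (T.deriv p) ps t * S ∧
        F.toFunP (T.deriv p) ps t * S ≤ ((tupperI S h (M.pmodelP prm S h c (T.deriv p) B csq).1 : ℤ) : ℝ) := by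
    intro t ht
    have hu : |t - c| ≤ (h : ℝ) := abs_le.2 ⟨by linarith [ht.1], by linarith [ht.2]⟩
    have h1 := tlowerI_le h0.le hWm hu
    have h2 := le_tupperI h0.le hWm hu
    have e : (c : ℝ) + (t - c) = t := by ring
    simp only [e] at h1 h2
    exact ⟨h1, h2⟩
  refine ⟨hS, h0, hder, ?_⟩
  cases up
  · simp only [cond_false, decide_eq_true_eq] at hs
    have hs' : ((tupperI S h (M.pmodelP prm S h c (T.deriv p) B csq).1 : ℤ) : ℝ) < 0 := by exact_mod_cast hs
    have hneg : ∀ t ∈ Icc ((c : ℝ) - h) ((c : ℝ) + h), F.toFunP (T.deriv p) ps t < 0 := by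
      intro t ht
      exact neg_of_mul_natCast_le (hD t ht).2 hs'
    refine ⟨[], List.Forall₂.nil, ?_, fun t => ?_⟩
    · simp only [List.nil_append, varRows_cons, monoDir_false, varRows_nil, and_true]
      push_cast
      exact ⟨by linarith, strictAntiOn_of_hasDerivAt_neg hder fun t ht => hneg t (Ioo_subset_Icc_self ht)⟩
    · simp only [List.map_nil, List.not_mem_nil, iff_false, not_and]
      intro ht
      push_cast at ht
      exact ne_of_lt (hneg t ht)
  · simp only [cond_true, decide_eq_true_eq] at hs
    have hs' : (0 : ℝ) < ((tlowerI S h (M.pmodelP prm S h c (T.deriv p) B csq).1 : ℤ) : ℝ) := by exact_mod_cast hs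
    have hpos : ∀ t ∈ Icc ((c : ℝ) - h) ((c : ℝ) + h), 0 < F.toFunP (T.deriv p) ps t := by
      intro t ht
      exact (mul_pos_iff_of_pos_right hSr).1 (lt_of_lt_of_le hs' (hD t ht).1)
    refine ⟨[], List.Forall₂.nil, ?_, fun t => ?_⟩
    · simp only [List.nil_append, varRows_cons, monoDir_true, varRows_nil, and_true]
      push_cast
      exact ⟨by linarith, strictMonoOn_of_hasDerivAt_pos hder fun t ht => hpos t (Ioo_subset_Icc_self ht)⟩
    · simp only [List.map_nil, List.not_mem_nil, iff_false, not_and]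
      intro ht
      push_cast at ht
      exact ne_of_gt (hpos t ht)

/-- **Soundness of the critical-point leaf**: `Ṗ` is the derivative on the leaf; there is exactly one critical
point `z` on the leaf, `c − h < zlo ≤ z ≤ zhi < c + h`; `P(ps; ·)` is strictly monotone in direction `¬isMin` on
`[c − h, z]` and `isMin` on `[z, c + h]` (so `z` is a strict local minimum / maximum); and the critical-value
candidate is correct at `z`. [cite: RatschekRokne1988, Sect. 3.11] [cite: Moore1979, Sect. 5.2 Thm 5.5–5.6] -/
theorem sound_of_critLeafCheck {prm : M.Prm} {S : ℕ} {p : GProg M} {B : PBox} {c h : ℚ}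
    {csp csq csd csg cse csv : List (List ℤ × ℕ)} {isMin : Bool} {zlo zhi : ℚ}
    (hc : T.critLeafCheck prm S p B c h csp csq csd csg cse csv isMin zlo zhi = true) {ps : List ℝ}
    (hB : BoxMem ps B) :
    0 < S ∧ 0 < h ∧ (∀ t ∈ Icc ((c : ℝ) - h) ((c : ℝ) + h), HasDerivAt (F.toFunP p ps) (F.toFunP (T.deriv p) ps t) t) ∧
      ∃ z : ℝ, (((zlo : ℚ) : ℝ) ≤ z ∧ z ≤ ((zhi : ℚ) : ℝ)) ∧ ((c : ℝ) - h < z ∧ z < (c : ℝ) + h) ∧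
        F.toFunP (T.deriv p) ps z = 0 ∧
        (∀ t ∈ Icc ((c : ℝ) - h) ((c : ℝ) + h), F.toFunP (T.deriv p) ps t = 0 → t = z) ∧
        MonoDir (F.toFunP p ps) (!isMin) ((c : ℝ) - h) z ∧ MonoDir (F.toFunP p ps) isMin z ((c : ℝ) + h) ∧
        (M.critVal prm S p B zlo zhi csv).1.ok S (F.toFunP p ps) z := by
  unfold OpTangentCore.critLeafCheck at hc
  simp only [Bool.and_eq_true] at hc
  obtain ⟨⟨⟨⟨hg, hE⟩, hs⟩, hV⟩, hN⟩ := hc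
  obtain ⟨hS, h0, hmono⟩ := T.strictMonoOn_or_strictAntiOn_of_newtonLeafCheck hN hB
  have hSr : (0 : ℝ) < S := by exact_mod_cast hS
  have hder := T.hasDerivAt_of_guardCheckP hg hB
  obtain ⟨⟨z, ⟨hz, hqz⟩, huniq⟩, henc⟩ := T.existsUnique_zero_of_newtonLeafCheck hN hB
  obtain ⟨hzb, hzi⟩ := henc z hz hqz
  have hEm := F.mem_pointI hS hE hB
  have hleft : (((c - h : ℚ)) : ℝ) ∈ Icc ((c : ℝ) - h) ((c : ℝ) + h) := by
    push_cast
    have : (0 : ℝ) < h := by exact_mod_cast h0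
    exact ⟨le_rfl, by linarith⟩
  have ecast : (((c - h : ℚ)) : ℝ) = (c : ℝ) - h := by push_cast; ring
  refine ⟨hS, h0, hder, z, hzb, hzi, hqz, fun t ht hqt => huniq t ⟨ht, hqt⟩, ?_⟩
  set f := F.toFunP p ps with hf
  set q := F.toFunP (T.deriv p) ps with hq
  have hVok := F.ok_critVal hS hV hB hzb
  cases isMin
  · -- local maximum: `q(c − h) > 0`, so `q` is strictly decreasing on the leaf
    simp only [cond_false, decide_eq_true_eq] at hs
    have hs' : (0 : ℝ) < q (((c - h : ℚ)) : ℝ) := by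
      have h1 : (0 : ℝ) < (((M.pointI prm S (T.deriv p) B (c - h) cse).1.lo : ℤ) : ℝ) := by exact_mod_cast hs
      exact (mul_pos_iff_of_pos_right hSr).1 (lt_of_lt_of_le h1 hEm.1)
    have hanti : StrictAntiOn q (Icc ((c : ℝ) - h) ((c : ℝ) + h)) := by
      rcases hmono with hm | hm
      · exfalso
        have := hm hleft hz (by rw [ecast]; exact hzi.1)
        rw [hqz] at this
        linarith
      · exact hm
    refine ⟨?_, ?_, hVok⟩
    · simp only [Bool.not_false, monoDir_true]
      refine strictMonoOn_of_hasDerivAt_pos (fun t ht => hder t ⟨ht.1, ht.2.trans hzi.2.le⟩) fun t ht => ?_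
      have := hanti ⟨ht.1.le, ht.2.le.trans hzi.2.le⟩ hz ht.2
      rwa [hqz] at this
    · simp only [monoDir_false]
      refine strictAntiOn_of_hasDerivAt_neg (fun t ht => hder t ⟨hzi.1.le.trans ht.1, ht.2⟩) fun t ht => ?_
      have := hanti hz ⟨hzi.1.le.trans ht.1.le, ht.2.le⟩ ht.1
      rwa [hqz] at this
  · -- local minimum: `q(c − h) < 0`, so `q` is strictly increasing on the leaf
    simp only [cond_true, decide_eq_true_eq] at hs
    have hs' : q (((c - h : ℚ)) : ℝ) < 0 := by
      have h1 : (((M.pointI prm S (T.deriv p) B (c - h) cse).1.hi : ℤ) : ℝ) < 0 := by exact_mod_cast hs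
      exact neg_of_mul_natCast_le hEm.2 h1
    have hmono' : StrictMonoOn q (Icc ((c : ℝ) - h) ((c : ℝ) + h)) := by
      rcases hmono with hm | hm
      · exact hm
      · exfalso
        have := hm hleft hz (by rw [ecast]; exact hzi.1)
        rw [hqz] at this
        linarith
    refine ⟨?_, ?_, hVok⟩
    · simp only [Bool.not_true, monoDir_false]
      refine strictAntiOn_of_hasDerivAt_neg (fun t ht => hder t ⟨ht.1, ht.2.trans hzi.2.le⟩) fun t ht => ?_
      have := hmono' ⟨ht.1.le, ht.2.le.trans hzi.2.le⟩ hz ht.2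
      rwa [hqz] at this
    · simp only [monoDir_true]
      refine strictMonoOn_of_hasDerivAt_pos (fun t ht => hder t ⟨hzi.1.le.trans ht.1, ht.2⟩) fun t ht => ?_
      have := hmono' hz ⟨hzi.1.le.trans ht.1.le, ht.2.le⟩ ht.1
      rwa [hqz] at this

/-- **The table claim of a critical-point leaf**: one critical row of direction `¬isMin` ending at the critical
point, final direction `isMin`. [cite: RatschekRokne1988, Sect. 3.11] -/
theorem eTable_of_critLeafCheck {prm : M.Prm} {S : ℕ} {p : GProg M} {B : PBox} {c h : ℚ}
    {csp csq csd csg cse csv : List (List ℤ × ℕ)} {isMin : Bool} {zlo zhi : ℚ}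
    (hc : T.critLeafCheck prm S p B c h csp csq csd csg cse csv isMin zlo zhi = true) {ps : List ℝ}
    (hB : BoxMem ps B) :
    ETable S (F.toFunP p ps) (F.toFunP (T.deriv p) ps) (c - h) (c + h)
      [(!isMin, (M.critVal prm S p B zlo zhi csv).1)] isMin := by
  obtain ⟨hS, h0, -, z, hzb, hzi, hqz, huniq, hm1, hm2, hok⟩ := T.sound_of_critLeafCheck hc hB
  refine ⟨[(!isMin, z)], List.Forall₂.cons ⟨rfl, hok⟩ List.Forall₂.nil, ?_, fun t => ?_⟩
  · simp only [List.cons_append, List.nil_append, varRows_cons, varRows_nil, and_true]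
    push_cast
    exact ⟨hzi.1, hm1, hzi.2, hm2⟩
  · simp only [List.map_cons, List.map_nil, List.mem_singleton]
    push_cast
    exact ⟨fun ht => huniq t ht.1 ht.2, fun ht => by rw [ht]; exact ⟨⟨hzi.1.le, hzi.2.le⟩, hqz⟩⟩

/-- A passing leaf has positive half-width (and `0 < S`). [cite: Kearfott1987, Sect. 1] -/
theorem h_pos_of_eLeafCheck {prm : M.Prm} {S : ℕ} {p : GProg M} {B : PBox} {l : ELeaf}
    (hc : T.eLeafCheck prm S p B l = true) {ps : List ℝ} (hB : BoxMem ps B) : 0 < S ∧ 0 < l.h := by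
  unfold OpTangentCore.eLeafCheck at hc
  split at hc
  · obtain ⟨hS, h0, -⟩ := T.sound_of_monoLeafCheck hc hB; exact ⟨hS, h0⟩
  · obtain ⟨hS, h0, -⟩ := T.sound_of_monoLeafCheck hc hB; exact ⟨hS, h0⟩
  · obtain ⟨hS, h0, -⟩ := T.sound_of_critLeafCheck hc hB; exact ⟨hS, h0⟩
  · obtain ⟨hS, h0, -⟩ := T.sound_of_critLeafCheck hc hB; exact ⟨hS, h0⟩

/-- **The derivative on a passing leaf.** [cite: GriewankWalther2008, Sect. 3.1 Table 3.4] -/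
theorem hasDerivAt_of_eLeafCheck {prm : M.Prm} {S : ℕ} {p : GProg M} {B : PBox} {l : ELeaf}
    (hc : T.eLeafCheck prm S p B l = true) {ps : List ℝ} (hB : BoxMem ps B) :
    ∀ t ∈ Icc ((l.c : ℝ) - l.h) ((l.c : ℝ) + l.h), HasDerivAt (F.toFunP p ps) (F.toFunP (T.deriv p) ps t) t := by
  unfold OpTangentCore.eLeafCheck at hc
  split at hc
  · exact (T.sound_of_monoLeafCheck hc hB).2.2.1
  · exact (T.sound_of_monoLeafCheck hc hB).2.2.1
  · exact (T.sound_of_critLeafCheck hc hB).2.2.1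
  · exact (T.sound_of_critLeafCheck hc hB).2.2.1

/-- **The table claim of a passing leaf**: specification `leafRows l`, final direction `l.kind.exit`.
[cite: RatschekRokne1988, Sect. 3.11] [cite: RatschekRokne1988, Sect. 3.12] -/
theorem eTable_of_eLeafCheck {prm : M.Prm} {S : ℕ} {p : GProg M} {B : PBox} {l : ELeaf}
    (hc : T.eLeafCheck prm S p B l = true) {ps : List ℝ} (hB : BoxMem ps B) :
    ETable S (F.toFunP p ps) (F.toFunP (T.deriv p) ps) (l.c - l.h) (l.c + l.h) (M.leafRows prm S p B l)
      l.kind.exit := by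
  unfold OpTangentCore.eLeafCheck at hc
  unfold OpModel.leafRows EKind.exit
  split at hc
  · exact (T.sound_of_monoLeafCheck hc hB).2.2.2
  · exact (T.sound_of_monoLeafCheck hc hB).2.2.2
  · exact T.eTable_of_critLeafCheck hc hB
  · exact T.eTable_of_critLeafCheck hc hB

/-- **The critical points of a passing leaf**: the zero-structure claim for `Ṗ(ps; ·)` on the leaf against the
leaf's claimed enclosures (none for a monotonicity leaf, one for a critical-point leaf).
[cite: RatschekRokne1988, Sect. 3.11] [cite: Moore1979, Sect. 5.2 Thm 5.5–5.6] -/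
theorem zclaim_of_eLeafCheck {prm : M.Prm} {S : ℕ} {p : GProg M} {B : PBox} {l : ELeaf}
    (hc : T.eLeafCheck prm S p B l = true) {ps : List ℝ} (hB : BoxMem ps B) :
    ZClaim (F.toFunP (T.deriv p) ps) (l.c - l.h) (l.c + l.h) (eEncls [l]) := by
  unfold OpTangentCore.eLeafCheck at hc
  simp only [eEncls, EKind.encl]
  split at hc
  · dsimp only
    obtain ⟨R, hF, -, hiff⟩ := (T.sound_of_monoLeafCheck hc hB).2.2.2
    have hR : R = [] := by cases hF; rfl
    subst hR
    exact ZClaim.of_forall_ne fun t ht hft => by simpa using (hiff t).1 ⟨ht, hft⟩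
  · dsimp only
    obtain ⟨R, hF, -, hiff⟩ := (T.sound_of_monoLeafCheck hc hB).2.2.2
    have hR : R = [] := by cases hF; rfl
    subst hR
    exact ZClaim.of_forall_ne fun t ht hft => by simpa using (hiff t).1 ⟨ht, hft⟩
  · dsimp only
    unfold OpTangentCore.critLeafCheck at hc
    simp only [Bool.and_eq_true] at hc
    obtain ⟨heu, henc⟩ := T.existsUnique_zero_of_newtonLeafCheck hc.2 hB
    refine ZClaim.of_existsUnique ?_ fun t ht hft => ?_
    · push_cast; exact heu
    · push_cast at ht ⊢; exact henc t ht hft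
  · dsimp only
    unfold OpTangentCore.critLeafCheck at hc
    simp only [Bool.and_eq_true] at hc
    obtain ⟨heu, henc⟩ := T.existsUnique_zero_of_newtonLeafCheck hc.2 hB
    refine ZClaim.of_existsUnique ?_ fun t ht hft => ?_
    · push_cast; exact heu
    · push_cast at ht ⊢; exact henc t ht hft

/-- **Local extremum on a critical-point leaf**: a leaf of kind `lmin zlo zhi` (`lmax zlo zhi`) carries a
critical point in `[zlo, zhi]` that is a local minimum (maximum) of `P(ps; ·)`. [cite: RatschekRokne1988, Sect. 3.11] -/
theorem isLocalExtr_of_eLeafCheck {prm : M.Prm} {S : ℕ} {p : GProg M} {B : PBox} {l : ELeaf}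
    (hc : T.eLeafCheck prm S p B l = true) {ps : List ℝ} (hB : BoxMem ps B) :
    ∀ zlo zhi : ℚ, (l.kind = EKind.lmin zlo zhi ∨ l.kind = EKind.lmax zlo zhi) →
      ∃ z : ℝ, (((zlo : ℚ) : ℝ) ≤ z ∧ z ≤ ((zhi : ℚ) : ℝ)) ∧ F.toFunP (T.deriv p) ps z = 0 ∧
        (l.kind = EKind.lmin zlo zhi → IsLocalMin (F.toFunP p ps) z) ∧
        (l.kind = EKind.lmax zlo zhi → IsLocalMax (F.toFunP p ps) z) := by
  intro zlo zhi hk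
  unfold OpTangentCore.eLeafCheck at hc
  rcases hk with hk | hk
  · simp only [hk] at hc
    obtain ⟨-, -, -, z, hzb, hzi, hqz, -, hm1, hm2, -⟩ := T.sound_of_critLeafCheck hc hB
    simp only [Bool.not_true, monoDir_false, monoDir_true] at hm1 hm2
    refine ⟨z, hzb, hqz, ?_, ?_⟩
    · intro
      have := VarRows.isLocalExtr_of_flip (f := F.toFunP p ps) (u := (l.c : ℝ) - l.h)
        (R := [(false, z), (true, (l.c : ℝ) + l.h)]) ⟨hzi.1, hm1, hzi.2, hm2, trivial⟩
        ((false, z), (true, (l.c : ℝ) + l.h)) (by simp)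
      exact this.1 rfl rfl
    · intro h'
      rw [hk] at h'
      cases h'
  · simp only [hk] at hc
    obtain ⟨-, -, -, z, hzb, hzi, hqz, -, hm1, hm2, -⟩ := T.sound_of_critLeafCheck hc hB
    simp only [Bool.not_false, monoDir_false, monoDir_true] at hm1 hm2
    refine ⟨z, hzb, hqz, ?_, ?_⟩
    · intro h'
      rw [hk] at h'
      cases h'
    · intro
      have := VarRows.isLocalExtr_of_flip (f := F.toFunP p ps) (u := (l.c : ℝ) - l.h)
        (R := [(true, z), (false, (l.c : ℝ) + l.h)]) ⟨hzi.1, hm1, hzi.2, hm2, trivial⟩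
        ((true, z), (false, (l.c : ℝ) + l.h)) (by simp)
      exact this.2 rfl rfl

end OpTangent


/-! ### Part C. The extrema certificate: leaves tiling `[a, b]`, endpoint values, claimed bounds -/

namespace OpModel

variable (M : OpModel)

/-- Under consistency, the first row of the table of `l :: L` has the entry direction of `l`.
[cite: RatschekRokne1988, Sect. 3.12] -/
theorem firstDir_eSpec (prm : M.Prm) (S : ℕ) (p : GProg M) (B : PBox) :
    ∀ (l : ELeaf) (L : List ELeaf), consistent (l :: L) = true →
      firstDir (M.eSpec prm S p B (l :: L)) (lastDir (l :: L)) = l.kind.entry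
  | l, [], _ => by
      simp only [OpModel.eSpec, List.append_nil, lastDir]
      unfold OpModel.leafRows EKind.entry EKind.exit
      cases l.kind <;> rfl
  | l, l' :: L, hc => by
      rw [consistent, Bool.and_eq_true, beq_iff_eq] at hc
      have ih := firstDir_eSpec prm S p B l' L hc.2
      have e1 : lastDir (l :: l' :: L) = lastDir (l' :: L) := rfl
      rw [OpModel.eSpec, e1]
      obtain ⟨hc1, -⟩ := hc
      unfold OpModel.leafRows
      cases hk : l.kind with
      | inc =>
          rw [hk] at hc1
          dsimp only
          rw [List.nil_append, ih, ← hc1]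
          rfl
      | dec =>
          rw [hk] at hc1
          dsimp only
          rw [List.nil_append, ih, ← hc1]
          rfl
      | lmin zlo zhi => rfl
      | lmax zlo zhi => rfl

end OpModel

/-- **An extrema certificate** for `P(ps; ·)` on `[a, b]`: the leaves, the candidates of the endpoint point
models, the CLAIMED enclosures `[mlo, mhi]` of the global minimum value and `[xlo, xhi]` of the global maximum
value, and optionally the claimed unique surviving minimiser / maximiser box.
[cite: RatschekRokne1988, Sect. 3.11] [cite: RatschekRokne1988, Sect. 3.8 Alg. 2] -/
structure ECert : Type where
  /-- leaves tiling `[a, b]` in order -/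
  L : List ELeaf
  /-- candidates: point model of `p` at `a` -/
  csa : List (List ℤ × ℕ)
  /-- candidates: point model of `p` at `b` -/
  csb : List (List ℤ × ℕ)
  /-- claimed lower bound of the minimum value -/
  mlo : ℚ
  /-- claimed upper bound of the minimum value -/
  mhi : ℚ
  /-- claimed lower bound of the maximum value -/
  xlo : ℚ
  /-- claimed upper bound of the maximum value -/
  xhi : ℚ
  /-- claimed box of the unique global minimiser, if claimed -/
  minBox : Option (ℚ × ℚ)
  /-- claimed box of the unique global maximiser, if claimed -/
  maxBox : Option (ℚ × ℚ)
  deriving Repr, Inhabited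

namespace OpModel

variable (M : OpModel)

/-- **The candidates of a certificate** in breakpoint order: endpoint `a`, the critical points, endpoint `b`.
[cite: RatschekRokne1988, Sect. 3.11] -/
def eVals (prm : M.Prm) (S : ℕ) (p : GProg M) (B : PBox) (a b : ℚ) (C : ECert) : List BVal :=
  (M.endVal prm S p B a C.csa).1 :: ((M.eSpec prm S p B C.L).map Prod.snd ++ [(M.endVal prm S p B b C.csb).1])

end OpModel

/-- A claimed unique box is THE list of survivors (no claim: nothing to check). [cite: RatschekRokne1988, Sect. 3.8 Alg. 2] -/
def boxClaimOK (claim : Option (ℚ × ℚ)) (surv : List (ℚ × ℚ)) : Bool :=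
  match claim with
  | none => true
  | some e => decide (surv = [e])

namespace OpModel

variable (M : OpModel)

/-- **The header of the extrema certificate check** (everything but the leaves): `0 < S`; the leaves are nonempty,
tile `[a, b]` in order and are consistent; the endpoint point models accepted; the claimed value bounds contain
the computed ones (`mlo·S ≤ minLo`, `minHi ≤ mhi·S`, `xlo·S ≤ maxLo`, `maxHi ≤ xhi·S` over the candidates
`eVals`); the claimed unique boxes are the survivor lists.
[cite: RatschekRokne1988, Sect. 3.11] [cite: RatschekRokne1988, Sect. 3.8 Alg. 2] -/
def extremaHdrCheck (prm : M.Prm) (S : ℕ) (p : GProg M) (B : PBox) (a b : ℚ) (C : ECert) : Bool :=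
  let V := M.eVals prm S p B a b C
  decide (0 < S) && !C.L.isEmpty && tiles a (C.L.map fun l => (l.c, l.h)) b && consistent C.L &&
    (M.endVal prm S p B a C.csa).2 && (M.endVal prm S p B b C.csb).2 &&
    decide (C.mlo * S ≤ ((minLo V : ℤ) : ℚ)) && decide (((minHi V : ℤ) : ℚ) ≤ C.mhi * S) &&
    decide (C.xlo * S ≤ ((maxLo V : ℤ) : ℚ)) && decide (((maxHi V : ℤ) : ℚ) ≤ C.xhi * S) &&
    boxClaimOK C.minBox (minSurv V) && boxClaimOK C.maxBox (maxSurv V)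

end OpModel

namespace OpTangentCore

variable {M : OpModel} (T : OpTangentCore M)

/-- **The extrema certificate check** for `P(ps; ·)` on `[a, b]`, uniformly over the parameter box: the header
(`extremaHdrCheck`) and every leaf passes.  One `decide +kernel` decides it; for a certificate too big for one
kernel call, decide the header and the leaves in chunks (`extremaCheck_of_parts`, `eLeavesCheck_of_take_drop`).
[cite: RatschekRokne1988, Sect. 3.11] [cite: RatschekRokne1988, Sect. 3.8 Alg. 2] [cite: Kearfott1987, Sect. 1] -/
def extremaCheck (prm : M.Prm) (S : ℕ) (p : GProg M) (B : PBox) (a b : ℚ) (C : ECert) : Bool :=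
  M.extremaHdrCheck prm S p B a b C && T.eLeavesCheck prm S p B C.L

/-- The leaves of a concatenation pass iff both parts pass. [cite: Kearfott1987, Sect. 1] -/
theorem eLeavesCheck_append (prm : M.Prm) (S : ℕ) (p : GProg M) (B : PBox) :
    ∀ L₁ L₂ : List ELeaf, T.eLeavesCheck prm S p B (L₁ ++ L₂) =
      (T.eLeavesCheck prm S p B L₁ && T.eLeavesCheck prm S p B L₂)
  | [], L₂ => by rw [List.nil_append, eLeavesCheck, Bool.true_and]
  | l :: L₁, L₂ => by rw [List.cons_append, eLeavesCheck, eLeavesCheck, eLeavesCheck_append prm S p B L₁ L₂, Bool.and_assoc]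

/-- **Chunked leaves**: the leaves pass if the first `n` and the remaining ones pass (two kernel calls instead of
one). [cite: Kearfott1987, Sect. 1] -/
theorem eLeavesCheck_of_take_drop {prm : M.Prm} {S : ℕ} {p : GProg M} {B : PBox} {L : List ELeaf} (n : ℕ)
    (h₁ : T.eLeavesCheck prm S p B (L.take n) = true) (h₂ : T.eLeavesCheck prm S p B (L.drop n) = true) :
    T.eLeavesCheck prm S p B L = true := by
  rw [← List.take_append_drop n L, eLeavesCheck_append, h₁, h₂, Bool.true_and]

/-- **Chunked certificate**: header and leaves decided separately. [cite: Kearfott1987, Sect. 1] -/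
theorem extremaCheck_of_parts {prm : M.Prm} {S : ℕ} {p : GProg M} {B : PBox} {a b : ℚ} {C : ECert}
    (h₁ : M.extremaHdrCheck prm S p B a b C = true) (h₂ : T.eLeavesCheck prm S p B C.L = true) :
    T.extremaCheck prm S p B a b C = true := by
  rw [extremaCheck, h₁, h₂, Bool.true_and]

end OpTangentCore

namespace OpTangent

variable {M : OpModel} {F : OpSem M} (T : OpTangent M F)

/-- Every leaf of a passing list passes. [cite: Kearfott1987, Sect. 1] -/
theorem eLeafCheck_of_mem {prm : M.Prm} {S : ℕ} {p : GProg M} {B : PBox} :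
    ∀ {L : List ELeaf}, T.eLeavesCheck prm S p B L = true → ∀ l ∈ L, T.eLeafCheck prm S p B l = true
  | [], _, l, hl => by simp at hl
  | l' :: L, hc, l, hl => by
      rw [OpTangentCore.eLeavesCheck, Bool.and_eq_true] at hc
      rcases List.mem_cons.1 hl with rfl | hl
      · exact hc.1
      · exact eLeafCheck_of_mem hc.2 l hl

/-- **Soundness along the chain** (nonempty consistent list of leaves tiling `[x, y]`): the derivative on
`[x, y]`, the table claim against `eSpec`, and the zero-structure claim for `Ṗ(ps; ·)` against `eEncls`.
[cite: RatschekRokne1988, Sect. 3.11] [cite: RatschekRokne1988, Sect. 3.12] [cite: Kearfott1987, Sect. 1] -/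
theorem sound_of_eLeavesCheck {prm : M.Prm} {S : ℕ} {p : GProg M} {B : PBox} {ps : List ℝ} (hB : BoxMem ps B) :
    ∀ (L : List ELeaf) (l : ELeaf) (x y : ℚ), tiles x ((l :: L).map fun l => (l.c, l.h)) y = true →
      T.eLeavesCheck prm S p B (l :: L) = true → consistent (l :: L) = true →
        (∀ t ∈ Icc ((x : ℚ) : ℝ) ((y : ℚ) : ℝ), HasDerivAt (F.toFunP p ps) (F.toFunP (T.deriv p) ps t) t) ∧
        ETable S (F.toFunP p ps) (F.toFunP (T.deriv p) ps) x y (M.eSpec prm S p B (l :: L)) (lastDir (l :: L)) ∧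
        ZClaim (F.toFunP (T.deriv p) ps) x y (eEncls (l :: L))
  | [], l, x, y, ht, hc, _ => by
      rw [List.map_cons, List.map_nil, tiles_cons] at ht
      simp only [tiles, Bool.and_eq_true, decide_eq_true_eq] at ht
      obtain ⟨⟨h1, -⟩, h3⟩ := ht
      simp only [OpTangentCore.eLeavesCheck, Bool.and_eq_true] at hc
      rw [← h1, ← h3]
      refine ⟨fun t ht => ?_, ?_, T.zclaim_of_eLeafCheck hc.1 hB⟩
      · push_cast at ht
        exact T.hasDerivAt_of_eLeafCheck hc.1 hB t ht
      · simp only [OpModel.eSpec, List.append_nil, lastDir]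
        exact T.eTable_of_eLeafCheck hc.1 hB
  | l' :: L, l, x, y, ht, hc, hcons => by
      rw [List.map_cons, tiles_cons] at ht
      simp only [Bool.and_eq_true, decide_eq_true_eq] at ht
      obtain ⟨⟨h1, h2⟩, h3⟩ := ht
      rw [OpTangentCore.eLeavesCheck, Bool.and_eq_true] at hc
      have hcons' : l.kind.exit = l'.kind.entry ∧ consistent (l' :: L) = true := by
        rw [consistent, Bool.and_eq_true, beq_iff_eq] at hcons
        exact hcons
      obtain ⟨ihd, iht, ihz⟩ := sound_of_eLeavesCheck hB L l' (l.c + l.h) y h3 hc.2 hcons'.2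
      have hmy : l.c + l.h ≤ y := le_of_tiles _ _ _ h3
      have hdl := T.hasDerivAt_of_eLeafCheck hc.1 hB
      rw [← h1]
      refine ⟨fun t ht => ?_, ?_, ?_⟩
      · push_cast at ht ihd
        rcases le_or_gt t ((l.c : ℝ) + l.h) with htm | htm
        · exact hdl t ⟨ht.1, htm⟩
        · exact ihd t ⟨htm.le, ht.2⟩
      · have e1 : lastDir (l :: l' :: L) = lastDir (l' :: L) := rfl
        rw [OpModel.eSpec, e1]
        refine ETable.append (by linarith) hmy (T.eTable_of_eLeafCheck hc.1 hB) iht ?_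
        rw [M.firstDir_eSpec prm S p B l' L hcons'.2]
        exact hcons'.1.symm
      · rw [eEncls_cons]
        exact ZClaim.append (by linarith) hmy (T.zclaim_of_eLeafCheck hc.1 hB) ihz

/-- [folklore] -/
private theorem unpack {prm : M.Prm} {S : ℕ} {p : GProg M} {B : PBox} {a b : ℚ} {C : ECert}
    (hc : T.extremaCheck prm S p B a b C = true) :
    0 < S ∧ (∃ l L, C.L = l :: L) ∧ tiles a (C.L.map fun l => (l.c, l.h)) b = true ∧ consistent C.L = true ∧
      (M.endVal prm S p B a C.csa).2 = true ∧ (M.endVal prm S p B b C.csb).2 = true ∧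
      (C.mlo * S ≤ ((minLo (M.eVals prm S p B a b C) : ℤ) : ℚ) ∧ ((minHi (M.eVals prm S p B a b C) : ℤ) : ℚ) ≤ C.mhi * S) ∧
      (C.xlo * S ≤ ((maxLo (M.eVals prm S p B a b C) : ℤ) : ℚ) ∧ ((maxHi (M.eVals prm S p B a b C) : ℤ) : ℚ) ≤ C.xhi * S) ∧
      boxClaimOK C.minBox (minSurv (M.eVals prm S p B a b C)) = true ∧
      boxClaimOK C.maxBox (maxSurv (M.eVals prm S p B a b C)) = true ∧ T.eLeavesCheck prm S p B C.L = true := by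
  unfold OpTangentCore.extremaCheck OpModel.extremaHdrCheck at hc
  simp only [Bool.and_eq_true, Bool.not_eq_true', decide_eq_true_eq] at hc
  obtain ⟨⟨⟨⟨⟨⟨⟨⟨⟨⟨⟨⟨hS, hne⟩, ht⟩, hcons⟩, ha⟩, hb⟩, h1⟩, h2⟩, h3⟩, h4⟩, h5⟩, h6⟩, hl⟩ := hc
  refine ⟨hS, ?_, ht, hcons, ha, hb, ⟨h1, h2⟩, ⟨h3, h4⟩, h5, h6, hl⟩
  match hL : C.L, hne with
  | l :: L, _ => exact ⟨l, L, rfl⟩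

/-- **Soundness of the extrema certificate, structural part**: the derivative on `[a, b]`, the variation-table
claim, and the critical points. [cite: RatschekRokne1988, Sect. 3.11] [cite: RatschekRokne1988, Sect. 3.12] -/
theorem sound_of_extremaCheck {prm : M.Prm} {S : ℕ} {p : GProg M} {B : PBox} {a b : ℚ} {C : ECert}
    (hc : T.extremaCheck prm S p B a b C = true) {ps : List ℝ} (hB : BoxMem ps B) :
    (∀ t ∈ Icc ((a : ℚ) : ℝ) ((b : ℚ) : ℝ), HasDerivAt (F.toFunP p ps) (F.toFunP (T.deriv p) ps t) t) ∧
      ETable S (F.toFunP p ps) (F.toFunP (T.deriv p) ps) a b (M.eSpec prm S p B C.L) (lastDir C.L) ∧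
      ZClaim (F.toFunP (T.deriv p) ps) a b (eEncls C.L) := by
  obtain ⟨-, ⟨l, L, hL⟩, ht, hcons, -, -, -, -, -, -, hl⟩ := T.unpack hc
  rw [hL] at ht hcons hl ⊢
  exact T.sound_of_eLeavesCheck hB L l a b ht hl hcons

/-- The rows with their candidate values: `P(ps; ·)` follows a variation table from `a` to `b` whose breakpoint
candidates are `eVals`. [cite: RatschekRokne1988, Sect. 3.11] -/
theorem rows_of_extremaCheck {prm : M.Prm} {S : ℕ} {p : GProg M} {B : PBox} {a b : ℚ} {C : ECert}
    (hc : T.extremaCheck prm S p B a b C = true) {ps : List ℝ} (hB : BoxMem ps B) :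
    ∃ R' : List (Bool × ℝ), VarRows (F.toFunP p ps) ((a : ℚ) : ℝ) R' ∧ rowsEnd ((a : ℚ) : ℝ) R' = ((b : ℚ) : ℝ) ∧
      List.Forall₂ (BVal.ok S (F.toFunP p ps)) (bps ((a : ℚ) : ℝ) R') (M.eVals prm S p B a b C) := by
  obtain ⟨hS, -, -, -, ha, hb, -⟩ := T.unpack hc
  obtain ⟨-, htab, -⟩ := T.sound_of_extremaCheck hc hB
  exact htab.rows (F.ok_endVal hS ha hB) (F.ok_endVal hS hb hB)

/-! #### The theorems delivered by a passing certificate -/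

/-- **(1) The derivative.**  `Ṗ(ps; t)` is the derivative of `P(ps; ·)` at every `t ∈ [a, b]`.
[cite: GriewankWalther2008, Sect. 3.1 Table 3.4] -/
theorem hasDerivAt_of_extremaCheck {prm : M.Prm} {S : ℕ} {p : GProg M} {B : PBox} {a b : ℚ} {C : ECert}
    (hc : T.extremaCheck prm S p B a b C = true) {ps : List ℝ} (hB : BoxMem ps B) :
    ∀ t ∈ Icc ((a : ℚ) : ℝ) ((b : ℚ) : ℝ), HasDerivAt (F.toFunP p ps) (F.toFunP (T.deriv p) ps t) t :=
  (T.sound_of_extremaCheck hc hB).1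

/-- **(2) The critical points.**  The zeros of `Ṗ(ps; ·)` on `[a, b]` ARE a strictly increasing list, one per
critical-point leaf and inside its claimed enclosure, in order. [cite: RatschekRokne1988, Sect. 3.11] [cite: Moore1979, Sect. 5.2 Thm 5.5–5.6] -/
theorem critical_of_extremaCheck {prm : M.Prm} {S : ℕ} {p : GProg M} {B : PBox} {a b : ℚ} {C : ECert}
    (hc : T.extremaCheck prm S p B a b C = true) {ps : List ℝ} (hB : BoxMem ps B) :
    ZClaim (F.toFunP (T.deriv p) ps) a b (eEncls C.L) :=
  (T.sound_of_extremaCheck hc hB).2.2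

/-- **Exactly `|eEncls C.L|` critical points on `[a, b]`.** [cite: RatschekRokne1988, Sect. 3.11] -/
theorem ncard_critical_of_extremaCheck {prm : M.Prm} {S : ℕ} {p : GProg M} {B : PBox} {a b : ℚ} {C : ECert}
    (hc : T.extremaCheck prm S p B a b C = true) {ps : List ℝ} (hB : BoxMem ps B) :
    {t : ℝ | t ∈ Icc ((a : ℚ) : ℝ) ((b : ℚ) : ℝ) ∧ F.toFunP (T.deriv p) ps t = 0}.ncard = (eEncls C.L).length :=
  (T.critical_of_extremaCheck hc hB).ncard_eq

/-- **(3) The variation table.**  There are rows `R` matching the specification `eSpec` (directions; critical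
points inside their boxes with their values enclosed) such that `P(ps; ·)` is strictly monotone row by row from
`a` to `b` in the stated directions, the critical points of `P(ps; ·)` on `[a, b]` ARE the row ends of `R`, and
every decreasing-then-increasing (increasing-then-decreasing) breakpoint is a local minimum (maximum).
[cite: RatschekRokne1988, Sect. 3.11] [cite: RatschekRokne1988, Sect. 3.12] -/
theorem varTable_of_extremaCheck {prm : M.Prm} {S : ℕ} {p : GProg M} {B : PBox} {a b : ℚ} {C : ECert}
    (hc : T.extremaCheck prm S p B a b C = true) {ps : List ℝ} (hB : BoxMem ps B) :
    ∃ R : List (Bool × ℝ), List.Forall₂ (RowOK S (F.toFunP p ps)) R (M.eSpec prm S p B C.L) ∧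
      VarRows (F.toFunP p ps) ((a : ℚ) : ℝ) (R ++ [(lastDir C.L, ((b : ℚ) : ℝ))]) ∧
      (∀ t : ℝ, (t ∈ Icc ((a : ℚ) : ℝ) ((b : ℚ) : ℝ) ∧ F.toFunP (T.deriv p) ps t = 0) ↔ t ∈ R.map Prod.snd) ∧
      ∀ q ∈ (R ++ [(lastDir C.L, ((b : ℚ) : ℝ))]).zip (R ++ [(lastDir C.L, ((b : ℚ) : ℝ))]).tail,
        (q.1.1 = false → q.2.1 = true → IsLocalMin (F.toFunP p ps) q.1.2) ∧
          (q.1.1 = true → q.2.1 = false → IsLocalMax (F.toFunP p ps) q.1.2) := by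
  obtain ⟨-, ⟨R, hF, hV, hiff⟩, -⟩ := T.sound_of_extremaCheck hc hB
  exact ⟨R, hF, hV, hiff, hV.isLocalExtr_of_flip⟩

/-- **(4) Local extrema.**  A leaf of kind `lmin zlo zhi` (`lmax zlo zhi`) carries a critical point in
`[zlo, zhi]` that is a local minimum (maximum) of `P(ps; ·)`. [cite: RatschekRokne1988, Sect. 3.11] -/
theorem isLocalExtr_of_extremaCheck {prm : M.Prm} {S : ℕ} {p : GProg M} {B : PBox} {a b : ℚ} {C : ECert}
    (hc : T.extremaCheck prm S p B a b C = true) {ps : List ℝ} (hB : BoxMem ps B) :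
    ∀ l ∈ C.L, ∀ zlo zhi : ℚ, (l.kind = EKind.lmin zlo zhi ∨ l.kind = EKind.lmax zlo zhi) →
      ∃ z : ℝ, (((zlo : ℚ) : ℝ) ≤ z ∧ z ≤ ((zhi : ℚ) : ℝ)) ∧ F.toFunP (T.deriv p) ps z = 0 ∧
        (l.kind = EKind.lmin zlo zhi → IsLocalMin (F.toFunP p ps) z) ∧
        (l.kind = EKind.lmax zlo zhi → IsLocalMax (F.toFunP p ps) z) := by
  obtain ⟨-, -, -, -, -, -, -, -, -, -, hl⟩ := T.unpack hc
  intro l hlm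
  exact T.isLocalExtr_of_eLeafCheck (T.eLeafCheck_of_mem hl l hlm) hB

/-- **(5) The global minimum value** lies in `[mlo, mhi]`: every value is at least `mlo`, some value is at most
`mhi`. [cite: RatschekRokne1988, Sect. 3.2 Alg. 1] [cite: RatschekRokne1988, Sect. 3.11] -/
theorem min_of_extremaCheck {prm : M.Prm} {S : ℕ} {p : GProg M} {B : PBox} {a b : ℚ} {C : ECert}
    (hc : T.extremaCheck prm S p B a b C = true) {ps : List ℝ} (hB : BoxMem ps B) :
    (∀ t ∈ Icc ((a : ℚ) : ℝ) ((b : ℚ) : ℝ), ((C.mlo : ℚ) : ℝ) ≤ F.toFunP p ps t) ∧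
      ∃ t ∈ Icc ((a : ℚ) : ℝ) ((b : ℚ) : ℝ), F.toFunP p ps t ≤ ((C.mhi : ℚ) : ℝ) := by
  obtain ⟨hS, -, -, -, -, -, ⟨h1, h2⟩, -⟩ := T.unpack hc
  obtain ⟨R', hR, hend, hV⟩ := T.rows_of_extremaCheck hc hB
  have hSr : (0 : ℝ) < S := by exact_mod_cast hS
  have h1' : ((C.mlo : ℚ) : ℝ) * S ≤ ((minLo (M.eVals prm S p B a b C) : ℤ) : ℝ) := by exact_mod_cast h1
  have h2' : ((minHi (M.eVals prm S p B a b C) : ℤ) : ℝ) ≤ ((C.mhi : ℚ) : ℝ) * S := by exact_mod_cast h2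
  rw [← hend]
  refine ⟨fun t ht => le_of_mul_le_mul_right (h1'.trans (hR.minLo_le hV t ht)) hSr, ?_⟩
  obtain ⟨t, ht, hle⟩ := hR.exists_le_minHi hV
  exact ⟨t, ht, le_of_mul_le_mul_right (hle.trans h2') hSr⟩

/-- **(5') The global maximum value** lies in `[xlo, xhi]`. [cite: RatschekRokne1988, Sect. 3.2 Alg. 1] [cite: RatschekRokne1988, Sect. 3.11] -/
theorem max_of_extremaCheck {prm : M.Prm} {S : ℕ} {p : GProg M} {B : PBox} {a b : ℚ} {C : ECert}
    (hc : T.extremaCheck prm S p B a b C = true) {ps : List ℝ} (hB : BoxMem ps B) :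
    (∀ t ∈ Icc ((a : ℚ) : ℝ) ((b : ℚ) : ℝ), F.toFunP p ps t ≤ ((C.xhi : ℚ) : ℝ)) ∧
      ∃ t ∈ Icc ((a : ℚ) : ℝ) ((b : ℚ) : ℝ), ((C.xlo : ℚ) : ℝ) ≤ F.toFunP p ps t := by
  obtain ⟨hS, -, -, -, -, -, -, ⟨h3, h4⟩, -⟩ := T.unpack hc
  obtain ⟨R', hR, hend, hV⟩ := T.rows_of_extremaCheck hc hB
  have hSr : (0 : ℝ) < S := by exact_mod_cast hS
  have h3' : ((C.xlo : ℚ) : ℝ) * S ≤ ((maxLo (M.eVals prm S p B a b C) : ℤ) : ℝ) := by exact_mod_cast h3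
  have h4' : ((maxHi (M.eVals prm S p B a b C) : ℤ) : ℝ) ≤ ((C.xhi : ℚ) : ℝ) * S := by exact_mod_cast h4
  rw [← hend]
  refine ⟨fun t ht => le_of_mul_le_mul_right ((hR.le_maxHi hV t ht).trans h4') hSr, ?_⟩
  obtain ⟨t, ht, hle⟩ := hR.exists_maxLo_le hV
  exact ⟨t, ht, le_of_mul_le_mul_right (h3'.trans hle) hSr⟩

/-- **(6) Every global minimiser lies in a surviving box** of `minSurv (eVals …)`. [cite: RatschekRokne1988, Sect. 3.8 Alg. 2] -/
theorem isMinOn_mem_of_extremaCheck {prm : M.Prm} {S : ℕ} {p : GProg M} {B : PBox} {a b : ℚ} {C : ECert}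
    (hc : T.extremaCheck prm S p B a b C = true) {ps : List ℝ} (hB : BoxMem ps B) :
    ∀ t ∈ Icc ((a : ℚ) : ℝ) ((b : ℚ) : ℝ), IsMinOn (F.toFunP p ps) (Icc ((a : ℚ) : ℝ) ((b : ℚ) : ℝ)) t →
      ∃ e ∈ minSurv (M.eVals prm S p B a b C), ((e.1 : ℚ) : ℝ) ≤ t ∧ t ≤ ((e.2 : ℚ) : ℝ) := by
  obtain ⟨R', hR, hend, hV⟩ := T.rows_of_extremaCheck hc hB
  rw [← hend]
  exact hR.minSurv_of_isMinOn hV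

/-- **(6') Every global maximiser lies in a surviving box** of `maxSurv (eVals …)`. [cite: RatschekRokne1988, Sect. 3.8 Alg. 2] -/
theorem isMaxOn_mem_of_extremaCheck {prm : M.Prm} {S : ℕ} {p : GProg M} {B : PBox} {a b : ℚ} {C : ECert}
    (hc : T.extremaCheck prm S p B a b C = true) {ps : List ℝ} (hB : BoxMem ps B) :
    ∀ t ∈ Icc ((a : ℚ) : ℝ) ((b : ℚ) : ℝ), IsMaxOn (F.toFunP p ps) (Icc ((a : ℚ) : ℝ) ((b : ℚ) : ℝ)) t →
      ∃ e ∈ maxSurv (M.eVals prm S p B a b C), ((e.1 : ℚ) : ℝ) ≤ t ∧ t ≤ ((e.2 : ℚ) : ℝ) := by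
  obtain ⟨R', hR, hend, hV⟩ := T.rows_of_extremaCheck hc hB
  rw [← hend]
  exact hR.maxSurv_of_isMaxOn hV

/-- **(7) Exactly one global minimiser** on `[a, b]` when the certificate claims the unique box `e`, and it lies
in `e`. [cite: RatschekRokne1988, Sect. 3.8 Alg. 2] [cite: RatschekRokne1988, Sect. 3.11] -/
theorem existsUnique_isMinOn_of_extremaCheck {prm : M.Prm} {S : ℕ} {p : GProg M} {B : PBox} {a b : ℚ}
    {C : ECert} (hc : T.extremaCheck prm S p B a b C = true) {e : ℚ × ℚ} (he : C.minBox = some e) {ps : List ℝ}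
    (hB : BoxMem ps B) :
    (∃! t, t ∈ Icc ((a : ℚ) : ℝ) ((b : ℚ) : ℝ) ∧ IsMinOn (F.toFunP p ps) (Icc ((a : ℚ) : ℝ) ((b : ℚ) : ℝ)) t) ∧
      ∀ t ∈ Icc ((a : ℚ) : ℝ) ((b : ℚ) : ℝ), IsMinOn (F.toFunP p ps) (Icc ((a : ℚ) : ℝ) ((b : ℚ) : ℝ)) t →
        ((e.1 : ℚ) : ℝ) ≤ t ∧ t ≤ ((e.2 : ℚ) : ℝ) := by
  obtain ⟨-, -, -, -, -, -, -, -, h5, -, -⟩ := T.unpack hc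
  rw [he] at h5
  simp only [boxClaimOK, decide_eq_true_eq] at h5
  obtain ⟨R', hR, hend, hV⟩ := T.rows_of_extremaCheck hc hB
  rw [← hend]
  exact hR.existsUnique_isMinOn hV h5

/-- **(7') Exactly one global maximiser** on `[a, b]` when the certificate claims the unique box `e`, and it lies
in `e`. [cite: RatschekRokne1988, Sect. 3.8 Alg. 2] [cite: RatschekRokne1988, Sect. 3.11] -/
theorem existsUnique_isMaxOn_of_extremaCheck {prm : M.Prm} {S : ℕ} {p : GProg M} {B : PBox} {a b : ℚ}
    {C : ECert} (hc : T.extremaCheck prm S p B a b C = true) {e : ℚ × ℚ} (he : C.maxBox = some e) {ps : List ℝ}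
    (hB : BoxMem ps B) :
    (∃! t, t ∈ Icc ((a : ℚ) : ℝ) ((b : ℚ) : ℝ) ∧ IsMaxOn (F.toFunP p ps) (Icc ((a : ℚ) : ℝ) ((b : ℚ) : ℝ)) t) ∧
      ∀ t ∈ Icc ((a : ℚ) : ℝ) ((b : ℚ) : ℝ), IsMaxOn (F.toFunP p ps) (Icc ((a : ℚ) : ℝ) ((b : ℚ) : ℝ)) t →
        ((e.1 : ℚ) : ℝ) ≤ t ∧ t ≤ ((e.2 : ℚ) : ℝ) := by
  obtain ⟨-, -, -, -, -, -, -, -, -, h6, -⟩ := T.unpack hc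
  rw [he] at h6
  simp only [boxClaimOK, decide_eq_true_eq] at h6
  obtain ⟨R', hR, hend, hV⟩ := T.rows_of_extremaCheck hc hB
  rw [← hend]
  exact hR.existsUnique_isMaxOn hV h6

end OpTangent


/-! ### Part D. Certificate generation (untrusted, outside the kernel; `#eval`) -/

namespace OpTangentCore

variable {M : OpModel} (T : OpTangentCore M)

/-- A monotonicity leaf `[e − k, e + k]` without candidates, direction `up`. [cite: RatschekRokne1988, Sect. 3.12] -/
def monoLeafOf (e k : ℚ) (up : Bool) : ELeaf :=
  ⟨e, k, [], [], [], [], [], [], bif up then EKind.inc else EKind.dec⟩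

/-- **Adaptive monotonicity tiling** of `[e − k, e + k]` by dyadic bisection (no certificate candidates): a leaf is
kept when `monoLeafCheck` accepts it with the direction read off the point value of `T.deriv p` at its centre,
else halved; `fuel` bounds the depth (PROPOSAL only — every leaf is re-checked by the kernel in
`extremaCheck`). [cite: RatschekRokne1988, Sect. 3.12] [cite: Kearfott1987, Sect. 1] -/
def monoAdapt (prm : M.Prm) (S : ℕ) (p : GProg M) (B : PBox) : ℕ → ℚ → ℚ → List ELeaf × Bool
  | 0, e, k =>
      let up := decide (0 < M.pointVal prm S (T.deriv p) B e)
      ([monoLeafOf e k up], T.monoLeafCheck prm S p B e k [] [] up)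
  | fuel + 1, e, k =>
      let up := decide (0 < M.pointVal prm S (T.deriv p) B e)
      if T.monoLeafCheck prm S p B e k [] [] up then ([monoLeafOf e k up], true)
      else
        let s := monoAdapt prm S p B fuel (e - k / 2) (k / 2)
        let t := monoAdapt prm S p B fuel (e + k / 2) (k / 2)
        (s.1 ++ t.1, s.2 && t.2)

/-- Monotonicity tiling of a gap `[x, y]` between critical-point leaves (empty when `x = y`, refused when `y < x`:
overlapping critical-point leaves). [cite: RatschekRokne1988, Sect. 3.12] [cite: Kearfott1987, Sect. 1] -/
def monoGap (prm : M.Prm) (S : ℕ) (p : GProg M) (B : PBox) (fuel : ℕ) (x y : ℚ) : List ELeaf × Bool :=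
  if x = y then ([], true) else if y < x then ([], false)
  else T.monoAdapt prm S p B fuel ((x + y) / 2) ((y - x) / 2)

/-- **A critical-point leaf proposal** at centre `c` with half-width `h`: the interval Newton proposal for the
program `T.deriv p` supplies the claimed enclosure (the kernel's own `[c − r, c + r]`); the kind is read off the
point value of `T.deriv p` at `c − h`; with its acceptance flag (PROPOSAL only).
[cite: RatschekRokne1988, Sect. 3.11] [cite: Moore1979, Sect. 5.2 Thm 5.5–5.6] -/
def critLeafOf (prm : M.Prm) (S : ℕ) (p : GProg M) (B : PBox) (c h : ℚ) : ELeaf × Bool :=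
  let nl := T.newtonLeafOf prm S (T.deriv p) B c h [] [] []
  let e : ℚ × ℚ := match nl.1.encl with
    | some e => e
    | none => (c, c)
  let isMin := decide (M.pointVal prm S (T.deriv p) B (c - h) < 0)
  let kind := bif isMin then EKind.lmin e.1 e.2 else EKind.lmax e.1 e.2
  (⟨c, h, [], [], [], [], [], [], kind⟩, T.critLeafCheck prm S p B c h [] [] [] [] [] [] isMin e.1 e.2)

/-- The leaves from `x` to `b` given the located critical points `z₁ < z₂ < …` (no certificate candidates):
monotonicity tiling of the gap up to `z₁ − hN`, the critical-point leaf `[z₁ − hN, z₁ + hN]`, and so on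
(PROPOSAL only). [cite: RatschekRokne1988, Sect. 3.11] [cite: Kearfott1987, Sect. 1] -/
def extremaGenFrom (prm : M.Prm) (S : ℕ) (p : GProg M) (B : PBox) (fuelE : ℕ) (hN : ℚ) :
    ℚ → List ℚ → ℚ → List ELeaf × Bool
  | x, [], b => T.monoGap prm S p B fuelE x b
  | x, z :: zs, b =>
      let g := T.monoGap prm S p B fuelE x (z - hN)
      let l := T.critLeafOf prm S p B z hN
      let rest := extremaGenFrom prm S p B fuelE hN (z + hN) zs b
      (g.1 ++ [l.1] ++ rest.1, g.2 && l.2 && rest.2)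

/-- The unique element of a one-element list, if it is one. [folklore] -/
private def theOnly : List (ℚ × ℚ) → Option (ℚ × ℚ)
  | [e] => some e
  | _ => none

/-- **The assembled extrema proposal** for `P(ps; ·)` on `[a, b]`: critical points located by a sign-change scan
of the point values of `T.deriv p` over `n` cells and `fuelB` bisection steps, a critical-point leaf of half-width
`hN` around each, monotonicity tilings of depth `≤ fuelE` in between; the claimed value bounds are the computed
ones (`minLo/S`, …) and the unique boxes are claimed exactly when one candidate survives; with the kernel's verdict
on the proposal (PROPOSAL only — the certificate is `T.extremaCheck prm S p B a b C` on the returned `C`).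
[cite: RatschekRokne1988, Sect. 3.11] [cite: RatschekRokne1988, Sect. 3.8 Alg. 2] [cite: Kearfott1987, Sect. 1] -/
def extremaGen (prm : M.Prm) (S : ℕ) (p : GProg M) (B : PBox) (a b : ℚ) (n fuelB fuelE : ℕ) (hN : ℚ) :
    ECert × Bool :=
  let q := T.deriv p
  let cells := M.scanCells prm S q B a b n
  let roots := cells.map fun e => M.bisectRoot prm S q B fuelB e.1 e.2
  let L := (T.extremaGenFrom prm S p B fuelE hN a roots b).1
  let V := M.eVals prm S p B a b ⟨L, [], [], 0, 0, 0, 0, none, none⟩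
  let C : ECert := ⟨L, [], [], ((minLo V : ℤ) : ℚ) / S, ((minHi V : ℤ) : ℚ) / S, ((maxLo V : ℤ) : ℚ) / S,
    ((maxHi V : ℤ) : ℚ) / S, theOnly (minSurv V), theOnly (maxSurv V)⟩
  (C, T.extremaCheck prm S p B a b C)

end OpTangentCore

end PolyMP

end Literature.Analysis.ValidatedNumerics
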